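import Literature.Probability.RandomPlanarGeometry.SAWWords
import Literature.Probability.RandomPlanarGeometry.HexSAWBrickWallStrip
import Mathlib.RingTheory.PowerSeries.Inverse
import Mathlib.Tactic
import HarnessLib

/-!
# The walk series of the one-cell honeycomb strip is rational:
# `Σ_N c_N(S_1) x^N = (4 + 10x + 12x² + 10x³ + 2x⁴ − 4x⁵ − 12x⁶ − 12x⁷ + 6x⁹ + 2x¹¹ + 2x¹²)/((1 − x² − x³)(1 − x⁴)²)`

Topic `Literature/Probability/RandomPlanarGeometry` (continues `HexSAWBrickWallStrip.lean`: the row strips `S_T = ℤ × {0,…,T}` of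
the brick wall = honeycomb lattice, `HexBW.stripPairs T N ≃ S_N(S_T)`, `HexBW.stripCount T N = c_N(S_T)` = the `N`-step
self-avoiding walks of `S_T` up to the translations of the strip; and `SAWWords.lean`: step words `List Step`, `traj`, `IsSAW`,
`words`, `wordOf`, `traj_wordOf`, `eq_of_traj_eq`).  Companion of `HexSAWBrickWallStripFugacityWidthOneExact.lean`, whose Part B
describes the structure of self-avoiding walks on the two-row ladder `S_1` qualitatively (runs, rungs at the even columns, at most
two reversals, dead-end corridors) to prove `μ(S_1)³ = μ(S_1) + 1`; here that structure is made EXACT and COUNTED: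

  ★★★ `stripCount_one_series : (Σ_N c_N(S_1) X^N) · (1 − X² − X³)(1 − X⁴)² = 4 + 10X + 12X² + 10X³ + 2X⁴ − 4X⁵ − 12X⁶ − 12X⁷
        + 6X⁹ + 2X¹¹ + 2X¹²`  (in `ℤ⟦X⟧`), with the order-11 linear recurrence `stripCount_one_rec`
        (`c_{n+13} = c_{n+11} + c_{n+10} + 2c_{n+9} − 2c_{n+7} − 2c_{n+6} − c_{n+5} + c_{n+3} + c_{n+2}`) and the first values
        `4, 10, 16, 24, 36, 56, 72` (`stripCount_one_values`).

Sources.  The objects: N. R. Beaton, M. Bousquet-Mélou, J. de Gier, H. Duminil-Copin, A. J. Guttmann, *The critical fugacity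
for surface adsorption of self-avoiding walks on the honeycomb lattice is `1+√2`*, Comm. Math. Phys. 326 (2014),
arXiv:1109.0358v5, §3.2 (the strips `S_T` of the honeycomb lattice and their walk counts; p. 12: "all series counting walks
in a strip that occur in this section [are] rational", citing the transfer-matrix method and [1] = S. E. Alm, S. Janson,
*Random self-avoiding walks on one-dimensional lattices*, Commun. Statist. Stochastic Models 6 (1990) 169–212, where the
rationality of the walk series of lattice strips is proved in general — no closed form for this strip is printed in either);
the method: R. P. Stanley, *Enumerative Combinatorics* vol. 1 (2nd ed., 2012), §4.7 "The transfer-matrix method"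
(Theorem 4.7.2: the walk series of a finite digraph is rational) and §4.1 (Theorem 4.1.1: rational series ⟺ linear
recurrence); N. Madras, G. Slade, *The Self-Avoiding Walk* (1993), §1.1 (walks as step sequences), §8.2 (walks in strips up to
translation, `c_N(S_T)`).  The automaton below is not finite (its states carry run lengths), which is why the denominator has the
non-cyclotomic factor `1 − x² − x³` (the plastic-number cubic of `μ(S_1)`, cf. the tree's
`HexBW.stripConnectiveConstant_one_pow_three`) next to `(1 − x⁴)²`; the closed forms are verified state by state by pure algebra,
and the automaton is proved to accept exactly the step words of the strip's self-avoiding walks by explicit phase invariants.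

## The automaton (start-column parity `p`; §1)

A walk prefix on the ladder `S_1 = ℤ × {0,1}` (horizontal bonds on both rows, rungs `{(x,0),(x,1)}` exactly at even `x`) is in
one of the states `LState`: `start`; `ini k` (initial horizontal run of length `k+1`, no rung yet); `rg1 a` (just after the FIRST
rung, initial run of length `a`); `ut i` (after a reversal at the first rung, walking back over the initial run, `i` of its sites
still ahead — no rung is possible there); `up k` (that U-turn has passed the starting column by `k+1`); `fwd k` (forward phase:
`k+1` steps since the last rung, which sits at an even column); `rg2 k` (just after a later rung whose approach run had length
`k+1`); `cor j` (the dead-end corridor after a reversal at such a rung: `j` free sites ahead, the row just left being visited at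
every column up to the previous rung).  The moves (`stepSum`, `W`; with headings and rows `fwdT`, `backT`, `rungT`, `δ`, `run`):
horizontal steps keep or start runs, a rung is available exactly at even columns and never twice in a row, a reversal after a
later rung enters a corridor of length one less than the approach run (`rg2 (j+1) → cor j`, none from `rg2 0`), a reversal at the
first rung walks back over the initial run (`rg1 (j+1) → ut j`) and, once past the start, continues as a forward phase measured
from the starting column (`up`).  `W p s m` = number of accepted continuations of length `m`;
`walkCount N = 2 (W 0 start N + W 1 start N)` (four starting sites `{0,1} × {0,1}` up to the translations `x ↦ x + 2`).

## Statements (namespace `Literature.Probability.RandomPlanarGeometry.SAW.HexBW.WidthOne`, all PROVED, standard axioms)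

ALGEBRA. §1 `LState`, `stepSum`, `W`, `W_zero`, `W_succ`, `map_stepSum`, `walkCount` (+ `decide`d values `4, …, 72`).
§2 `pA = 1−X`, `pB = 1−X²`, `pC = 1−X⁴`, `pE = 1−X²−X³`, `N6 = 1−2X⁴+X⁶`, `D = pA·pB·pC²·pE`, `uD = D⁻¹` (`D_mul_uD`, `huD`), the
numerators `polF1` (forward series `F = (1−2x⁴+x⁶)/((1−x)(1−x⁴)(1−x²−x³))`), `polCor`, `polRg2`, `polFwdLike`, `polFwd`,
`polUp`, `polV0`, `polU0` (`polUp_zero`), `polUt`, `polRg1`, `polIni`, `polStart`, `pol`, `Ψ p s = pol p s · D⁻¹`.  §3 the sixteen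
one-step identities `Ψ_cor_zero` … `Ψ_start_of_odd` (each `linear_combination huD`) and ★ `Ψ_eq_one_add_X_mul_stepSum :
Ψ p s = 1 + X · stepSum p (Ψ p) s`.  §4 `constantCoeff_pol`, `coeff_zero_Ψ`, `coeff_succ_Ψ`, ★★ **`coeff_Ψ_eq_W :
[X^m] Ψ p s = W p s m`** (induction on `m`, all states at once), `mk_W_eq_Ψ`.  §5 `walkP`, ★★ **`walkCount_series :
(Σ_N walkCount N X^N) · (1 − X² − X³)(1 − X⁴)² = walkP`**, `coeff_walkP_eq_zero`, `coeff_add_mk_mul_X_pow`, ★ `walkCount_rec`.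
GEOMETRY. §6 `VisAt a w cx cy` (the site `(cx,cy)` is visited by the word `w` placed at `a`), **`Good a w`** (`w` placed at `a` is
a brick-wall SAW staying in `S_1` — the three conditions of `stripPairs 1`), `visAt_start`, `visAt_end`, `visAt_snoc_iff`,
`good_nil`, ★ `good_snoc_iff` (one more letter: fresh site, brick-wall bond, in the strip), ★ `mem_stripPairs_iff_good`.
§7 `GState` (state, heading, row), `fwdT`, `backT`, `rungT`, **`δ`** (transition on letters `Step = Fin 4`), `run`, `startG`,
`run_nil`, `run_cons`, `run_snoc`, `HOk`, `acc`, `words_succ`, `card_acc_succ`, ★★ **`card_acc : #acc p g m = W p g.s m`**.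
§8 **`InvS`** (the phase invariants on an abstract visited predicate `V : ℤ → ℤ → Prop`: the visited columns and rows each state
needs to know — e.g. for `fwd k`: all visited sites lie strictly behind the current column except the current one, the other row
is visited only up to the last rung column `c`, the foot `(c, other row)` of the last rung and the current run are visited),
`V'`, `StepOK`, `vcongr`, `step_cases`, `δ_eq_some`, `δ_isSome_of`, `StepConcl`, and for every state ★ `step_<state>` (a
successful transition lands on a fresh site through a brick-wall bond inside the strip and re-establishes the invariant) and
★ `block_<state>` (a good letter is never rejected); `step_all`, `block_all`.  §9 `WInv`, `adj_iff_of_rows`, ★★ **`good_iff_run`**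
(the main induction along the word), ★★ `good_iff_isSome` (**the automaton accepts exactly the step words of the SAWs of `S_1`**),
`filter_stripPairs_eq`, `card_filter_stripPairs`, `stripStarts_one`, ★★★ **`stripCount_one_eq_walkCount : c_N(S_1) = walkCount N`**,
★★★ **`stripCount_one_series`**, ★★ `stripCount_one_rec`, `stripCount_one_values`.
§CF (ed.3) A CLOSED FORM à la Zeilberger (Stanley Thm 4.1.1 (iii) made explicit and integral): `plast` (`u_0,u_1,u_2 = 436, 592, 724`,
`u_{N+3} = u_{N+1} + u_N`), `corr` (`ε(N)` linear on each residue class mod 4), `plast_sub_corr_rec`, `walkCount_closed_form`,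
★★ **`stripCount_one_closed_form : 2 ≤ N → 25 · c_N(S_1) = u_N − ε(N)`**.

NOT here: the two-fugacity series `Σ C_{1,N}(y,z) x^N = P(x,y,z)/([(1−yx²)(1−zx²) − yzx⁶](1−yzx⁴)²)` (same automaton with site
weights; its pole is the sextic law of `HexSAWBrickWallStripFugacityWidthOneExact.lean` / `…SexticLower.lean`) — since landed as
`HexSAWBrickWallStripFugacityWidthOneSeries.lean`; widths `T ≥ 2`
(no finite phase structure with counters of this kind is exact there: reversals into hooks of every length occur).
-/

noncomputable section

open Finset PowerSeries Literature.Probability.LatticeModels Literature.Probability.Percolation SimpleGraph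

namespace Literature.Probability.RandomPlanarGeometry.SAW.HexBW

namespace WidthOne

/-- The states of the counting automaton of self-avoiding walks on the two-row brick-wall ladder `S_1 = ℤ × {0,1}`
(rungs at the even columns), read along a walk prefix; the natural-number data are run lengths (shifted so that every
value is meaningful):
* `start` — no step taken yet;
* `ini k` — initial horizontal run of length `k + 1`, no rung yet;
* `rg1 a` — just after the FIRST rung, the initial run having length `a`;
* `ut i` — walking back over the initial run after a reversal at the first rung, `i` more sites of the initial run ahead;
* `up k` — after such a U-turn, `k + 1` columns beyond the starting column (heading away from the start);
* `fwd k` — forward phase: at least one rung taken, `k + 1` horizontal steps since the last rung, no reversal pending;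
* `rg2 k` — just after a NON-first rung (or a rung of the `up` phase) whose approach run had length `k + 1`;
* `cor j` — in the dead-end corridor after a reversal at such a rung, `j` more free sites ahead.
[cite: Stanley2012EC1, §4.7 (transfer-matrix method); AlmJanson1990, §2 (SAWs on one-dimensional lattices)] -/
inductive LState
  | start
  | ini (k : ℕ)
  | rg1 (a : ℕ)
  | ut (i : ℕ)
  | up (k : ℕ)
  | fwd (k : ℕ)
  | rg2 (k : ℕ)
  | cor (j : ℕ)
  deriving DecidableEq, Repr

open LState

/-- **One step of the automaton, as a weighted sum over the successor states.**  `p` is the parity of the starting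
column (rungs exist at even columns only): from `start` two horizontal moves to `ini 0` and, if the start column is even,
a rung to `rg1 0`; from `ini k` a forward move and, if the column `p + k + 1` is even, a rung to `rg1 (k+1)`; from `rg1 0`
two horizontal moves (no heading yet) to `fwd 0`, from `rg1 (j+1)` forward to `fwd 0` or backward to `ut j`; `ut (i+1) → ut i`,
`ut 0 → up 0`; from `up k` forward to `up (k+1)` and, at an even column, a rung to `rg2 k`; from `fwd k` forward to
`fwd (k+1)` and, when `k + 1` is even, a rung to `rg2 k`; from `rg2 k` forward to `fwd 0` and, if `k ≥ 1`, backward into the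
corridor `cor (k-1)`; `cor (j+1) → cor j`, `cor 0` is stuck.
[cite: Stanley2012EC1, §4.7 (transfer-matrix method, Theorem 4.7.2)] -/
def stepSum {α : Type*} [AddCommMonoid α] (p : ℕ) (f : LState → α) : LState → α
  | start => 2 • f (ini 0) + (if Even p then f (rg1 0) else 0)
  | ini k => f (ini (k + 1)) + (if Even (p + k + 1) then f (rg1 (k + 1)) else 0)
  | rg1 0 => 2 • f (fwd 0)
  | rg1 (j + 1) => f (fwd 0) + f (ut j)
  | ut 0 => f (up 0)
  | ut (i + 1) => f (ut i)
  | up k => f (up (k + 1)) + (if Even (p + k + 1) then f (rg2 k) else 0)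
  | fwd k => f (fwd (k + 1)) + (if Even (k + 1) then f (rg2 k) else 0)
  | rg2 0 => f (fwd 0)
  | rg2 (j + 1) => f (fwd 0) + f (cor j)
  | cor 0 => 0
  | cor (j + 1) => f (cor j)

/-- **The number `W p s m` of accepted continuations of length `m` from state `s`** (start-column parity `p`):
`W p s 0 = 1`, `W p s (m+1) = Σ_{s → s'} W p s' m`. [cite: Stanley2012EC1, §4.7 (transfer-matrix method)] -/
def W (p : ℕ) : LState → ℕ → ℕ
  | _, 0 => 1
  | start, m + 1 => 2 * W p (ini 0) m + (if Even p then W p (rg1 0) m else 0)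
  | ini k, m + 1 => W p (ini (k + 1)) m + (if Even (p + k + 1) then W p (rg1 (k + 1)) m else 0)
  | rg1 0, m + 1 => 2 * W p (fwd 0) m
  | rg1 (j + 1), m + 1 => W p (fwd 0) m + W p (ut j) m
  | ut 0, m + 1 => W p (up 0) m
  | ut (i + 1), m + 1 => W p (ut i) m
  | up k, m + 1 => W p (up (k + 1)) m + (if Even (p + k + 1) then W p (rg2 k) m else 0)
  | fwd k, m + 1 => W p (fwd (k + 1)) m + (if Even (k + 1) then W p (rg2 k) m else 0)
  | rg2 0, m + 1 => W p (fwd 0) m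
  | rg2 (j + 1), m + 1 => W p (fwd 0) m + W p (cor j) m
  | cor 0, _ + 1 => 0
  | cor (j + 1), m + 1 => W p (cor j) m

/-- `W p s 0 = 1`. [cite: Stanley2012EC1, §4.7] -/
@[simp] theorem W_zero (p : ℕ) (s : LState) : W p s 0 = 1 := by
  cases s <;> rfl

/-- The recursion of `W` is `stepSum`. [cite: Stanley2012EC1, §4.7 (transfer-matrix method)] -/
theorem W_succ (p : ℕ) (s : LState) (m : ℕ) : W p s (m + 1) = stepSum p (fun t => W p t m) s := by
  rcases s with _ | k | (_ | j) | (_ | i) | k | k | (_ | j) | (_ | j) <;> simp [W, stepSum]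

/-- `stepSum` commutes with additive maps. [cite: Stanley2012EC1, §4.7] -/
theorem map_stepSum {α β : Type*} [AddCommMonoid α] [AddCommMonoid β] (φ : α →+ β) (p : ℕ) (f : LState → α)
    (s : LState) : φ (stepSum p f s) = stepSum p (fun t => φ (f t)) s := by
  rcases s with _ | k | (_ | j) | (_ | i) | k | k | (_ | j) | (_ | j) <;> simp [stepSum, apply_ite φ]

/-- The walk counts of the strip up to translation: four starting sites, two of each column parity.
`walkCount N = 2 (W 0 start N + W 1 start N)`. [cite: MadrasSlade1993, §8.2, eq. (8.2.1)] -/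
def walkCount (N : ℕ) : ℕ := 2 * (W 0 start N + W 1 start N)

/-- Sanity values: `walkCount N = 4, 10, 16, 24, 36, 56, 72` for `N ≤ 6` (the brute-force counts `c_N(S_1)`).
[cite: MadrasSlade1993, §8.2] -/
example : (List.range 7).map walkCount = [4, 10, 16, 24, 36, 56, 72] := by decide


/-! ## §2 The closed forms

All generating functions `Σ_m W p s m X^m` are rational with denominator dividing
`D = (1 − X)(1 − X²)(1 − X⁴)²(1 − X² − X³)`; we write each as `pol p s · D⁻¹` with an explicit polynomial numerator. -/

/-- `1 − X`. [cite: Stanley2012EC1, §4.1 (Theorem 4.1.1: rational generating functions)] -/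
def pA : ℤ⟦X⟧ := 1 - X
/-- `1 − X²`. [cite: Stanley2012EC1, §4.1 (Theorem 4.1.1)] -/
def pB : ℤ⟦X⟧ := 1 - X ^ 2
/-- `1 − X⁴`. [cite: Stanley2012EC1, §4.1 (Theorem 4.1.1)] -/
def pC : ℤ⟦X⟧ := 1 - X ^ 4
/-- `1 − X² − X³` (the plastic-number factor: `μ(S_1)³ = μ(S_1) + 1`). [cite: Stanley2012EC1, §4.1 (Theorem 4.1.1)] -/
def pE : ℤ⟦X⟧ := 1 - X ^ 2 - X ^ 3
/-- `1 − 2X⁴ + X⁶`, the numerator of the forward series. [cite: Stanley2012EC1, §4.1 (Theorem 4.1.1)] -/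
def N6 : ℤ⟦X⟧ := 1 - 2 * X ^ 4 + X ^ 6
/-- The common denominator `D = (1 − X)(1 − X²)(1 − X⁴)²(1 − X² − X³)`. [cite: Stanley2012EC1, §4.1 (Theorem 4.1.1)] -/
def D : ℤ⟦X⟧ := pA * pB * pC ^ 2 * pE

/-- `D` has constant coefficient `1`. [cite: Stanley2012EC1, §4.1] -/
theorem constantCoeff_D : constantCoeff D = 1 := by
  simp [D, pA, pB, pC, pE]

/-- `D⁻¹` in `ℤ⟦X⟧`. [cite: Stanley2012EC1, §4.1 (Theorem 4.1.1)] -/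
def uD : ℤ⟦X⟧ := PowerSeries.invOfUnit D 1

/-- `D · D⁻¹ = 1`. [cite: Stanley2012EC1, §4.1] -/
theorem D_mul_uD : D * uD = 1 :=
  PowerSeries.mul_invOfUnit D 1 (by rw [constantCoeff_D]; rfl)

/-- `D⁻¹` has constant coefficient `1`. [cite: Stanley2012EC1, §4.1] -/
theorem constantCoeff_uD : constantCoeff uD = 1 := by
  rw [uD, PowerSeries.constantCoeff_invOfUnit]; rfl

/-- Numerator of the forward series `F = Σ_m W p (fwd 0) m X^m = (1 − 2X⁴ + X⁶)/((1−X)(1−X⁴)(1−X²−X³))`.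
[cite: Stanley2012EC1, §4.7 (transfer-matrix method)] -/
def polF1 : ℤ⟦X⟧ := N6 * pB * pC

/-- Numerator for the corridor `cor j`: `(1 − X^{j+1})/(1 − X)`. [cite: Stanley2012EC1, §4.7] -/
def polCor (j : ℕ) : ℤ⟦X⟧ := (1 - X ^ (j + 1)) * pB * pC ^ 2 * pE

/-- Numerator after a later rung `rg2 k`: `1 + X·F + X(1 − X^k)/(1 − X)`. [cite: Stanley2012EC1, §4.7] -/
def polRg2 (k : ℕ) : ℤ⟦X⟧ := D + X * polF1 + X * (1 - X ^ k) * pB * pC ^ 2 * pE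

/-- Numerator of a forward-type phase with `k + 1` steps run and rung-parity offset `q ∈ {0,1}` (next rung after `q`, `q+2`, …
more steps): `1/(1−X) + X^{q+1}/((1−X)(1−X²)) + X^{q+2} F/(1−X²) − X^{k+2q+2}/((1−X)(1−X⁴))`.
[cite: Stanley2012EC1, §4.7 (transfer-matrix method)] -/
def polFwdLike (k q : ℕ) : ℤ⟦X⟧ :=
  pB * pC ^ 2 * pE + X ^ (q + 1) * pC ^ 2 * pE + X ^ (q + 2) * N6 * pC - X ^ (k + 2 * q + 2) * pB * pC * pE

/-- Numerator for `fwd k` (rung allowed when the run length is even). [cite: Stanley2012EC1, §4.7] -/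
def polFwd (k : ℕ) : ℤ⟦X⟧ := polFwdLike k ((k + 1) % 2)

/-- Numerator for `up k` (rung allowed when the column `p + k + 1` past the start is even). [cite: Stanley2012EC1, §4.7] -/
def polUp (p k : ℕ) : ℤ⟦X⟧ := polFwdLike k ((p + k + 1) % 2)

/-- The start-parity-dependent part of the numerator for `up 0`: with `q' = (p+1) mod 2`,
`X^{q'+1}(1−X⁴)(1−X²−X³) + X^{q'+2}(1−2X⁴+X⁶) − X^{2q'+2}(1−X²)(1−X²−X³)`. [cite: Stanley2012EC1, §4.7] -/
def polV0 (p : ℕ) : ℤ⟦X⟧ :=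
  X ^ ((p + 1) % 2 + 1) * pC * pE + X ^ ((p + 1) % 2 + 2) * N6 - X ^ (2 * ((p + 1) % 2) + 2) * pB * pE

/-- Numerator for `up 0`: `(1−X²)(1−X⁴)²(1−X²−X³) + (1−X⁴)·polV0`. [cite: Stanley2012EC1, §4.7] -/
def polU0 (p : ℕ) : ℤ⟦X⟧ := pB * pC ^ 2 * pE + pC * polV0 p

/-- `polUp p 0 = polU0 p`. [cite: Stanley2012EC1, §4.7] -/
theorem polUp_zero (p : ℕ) : polUp p 0 = polU0 p := by
  simp only [polUp, polU0, polV0, polFwdLike, Nat.add_zero, pB, pC, pE, N6]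
  ring

/-- Numerator for the U-turn phase `ut i`: `(1 − X^{i+1})/(1−X) + X^{i+1}·U₀`. [cite: Stanley2012EC1, §4.7] -/
def polUt (p i : ℕ) : ℤ⟦X⟧ := (1 - X ^ (i + 1)) * pB * pC ^ 2 * pE + X ^ (i + 1) * polU0 p

/-- Numerator just after the first rung `rg1 a`. [cite: Stanley2012EC1, §4.7] -/
def polRg1 (p : ℕ) : ℕ → ℤ⟦X⟧
  | 0 => D + 2 * X * polF1
  | j + 1 => D + X * polF1 + X * polUt p j

/-- Numerator for the initial run `ini k`. [cite: Stanley2012EC1, §4.7] -/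
def polIni (p k : ℕ) : ℤ⟦X⟧ :=
  pB * pC ^ 2 * pE + X ^ ((p + k + 1) % 2 + 1) * pC ^ 2 * pE + X ^ ((p + k + 1) % 2 + 2) * N6 * pC +
    X ^ (k + 2 * ((p + k + 1) % 2) + 3) * polV0 p

/-- Numerator for `start`. [cite: Stanley2012EC1, §4.7] -/
def polStart (p : ℕ) : ℤ⟦X⟧ := D + 2 * X * polIni p 0 + (if Even p then X * polRg1 p 0 else 0)

/-- The numerators, by state. [cite: Stanley2012EC1, §4.7 (transfer-matrix method)] -/
def pol (p : ℕ) : LState → ℤ⟦X⟧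
  | start => polStart p
  | ini k => polIni p k
  | rg1 a => polRg1 p a
  | ut i => polUt p i
  | up k => polUp p k
  | fwd k => polFwd k
  | rg2 k => polRg2 k
  | cor j => polCor j

/-- The closed form of the state series: `Ψ p s = pol p s · D⁻¹`. [cite: Stanley2012EC1, §4.7] -/
def Ψ (p : ℕ) (s : LState) : ℤ⟦X⟧ := pol p s * uD

/-! ## §3 The one-step identities `Ψ s = 1 + X · Σ_{s → s'} Ψ s'` -/

/-- `D · D⁻¹ = 1`, expanded. [cite: Stanley2012EC1, §4.1] -/
theorem huD : (1 - X) * (1 - X ^ 2) * (1 - X ^ 4) ^ 2 * (1 - X ^ 2 - X ^ 3) * uD = (1 : ℤ⟦X⟧) := by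
  have h := D_mul_uD; simp only [D, pA, pB, pC, pE] at h; exact h

section identities

variable (p : ℕ)

/-- Corridor, stuck: `Ψ (cor 0) = 1`. [cite: Stanley2012EC1, §4.7] -/
theorem Ψ_cor_zero : Ψ p (cor 0) = 1 + X * (0 : ℤ⟦X⟧) := by
  simp only [Ψ, pol, polCor, pB, pC, pE]
  linear_combination huD

/-- Corridor step: `Ψ (cor (j+1)) = 1 + X Ψ (cor j)`. [cite: Stanley2012EC1, §4.7] -/
theorem Ψ_cor_succ (j : ℕ) : Ψ p (cor (j + 1)) = 1 + X * Ψ p (cor j) := by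
  simp only [Ψ, pol, polCor, pB, pC, pE]
  linear_combination huD

/-- After a later rung, no corridor: `Ψ (rg2 0) = 1 + X Ψ (fwd 0)`. [cite: Stanley2012EC1, §4.7] -/
theorem Ψ_rg2_zero : Ψ p (rg2 0) = 1 + X * Ψ p (fwd 0) := by
  simp only [Ψ, pol, polRg2, polFwd, polFwdLike, polF1, D, pA, pB, pC, pE, N6]
  linear_combination huD

/-- After a later rung: `Ψ (rg2 (j+1)) = 1 + X (Ψ (fwd 0) + Ψ (cor j))`. [cite: Stanley2012EC1, §4.7] -/
theorem Ψ_rg2_succ (j : ℕ) : Ψ p (rg2 (j + 1)) = 1 + X * (Ψ p (fwd 0) + Ψ p (cor j)) := by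
  simp only [Ψ, pol, polRg2, polFwd, polFwdLike, polCor, polF1, D, pA, pB, pC, pE, N6]
  linear_combination huD

/-- Forward, odd run length `2i+1` (`k = 2i`): no rung. [cite: Stanley2012EC1, §4.7] -/
theorem Ψ_fwd_even (i : ℕ) : Ψ p (fwd (2 * i)) = 1 + X * Ψ p (fwd (2 * i + 1)) := by
  simp only [Ψ, pol, polFwd, polFwdLike, pB, pC, pE, N6]
  rw [show (2 * i + 1) % 2 = 1 by omega, show (2 * i + 1 + 1) % 2 = 0 by omega]
  linear_combination huD

/-- Forward, even run length `2i+2` (`k = 2i+1`): rung allowed. [cite: Stanley2012EC1, §4.7] -/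
theorem Ψ_fwd_odd (i : ℕ) : Ψ p (fwd (2 * i + 1)) = 1 + X * (Ψ p (fwd (2 * i + 2)) + Ψ p (rg2 (2 * i + 1))) := by
  simp only [Ψ, pol, polFwd, polRg2, polFwdLike, polF1, D, pA, pB, pC, pE, N6]
  rw [show (2 * i + 1 + 1) % 2 = 0 by omega, show (2 * i + 2 + 1) % 2 = 1 by omega]
  linear_combination huD

/-- U-turn pass, even column: rung allowed. [cite: Stanley2012EC1, §4.7] -/
theorem Ψ_up_of_even (k : ℕ) (h : (p + k + 1) % 2 = 0) :
    Ψ p (up k) = 1 + X * (Ψ p (up (k + 1)) + Ψ p (rg2 k)) := by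
  have h' : (p + (k + 1) + 1) % 2 = 1 := by omega
  simp only [Ψ, pol, polUp, polRg2, h, h', polFwdLike, polF1, D, pA, pB, pC, pE, N6]
  linear_combination huD

/-- U-turn pass, odd column: no rung. [cite: Stanley2012EC1, §4.7] -/
theorem Ψ_up_of_odd (k : ℕ) (h : (p + k + 1) % 2 = 1) :
    Ψ p (up k) = 1 + X * Ψ p (up (k + 1)) := by
  have h' : (p + (k + 1) + 1) % 2 = 0 := by omega
  simp only [Ψ, pol, polUp, h, h', polFwdLike, pB, pC, pE, N6]
  linear_combination huD

/-- Above the start after the U-turn: `Ψ (ut 0) = 1 + X Ψ (up 0)`. [cite: Stanley2012EC1, §4.7] -/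
theorem Ψ_ut_zero : Ψ p (ut 0) = 1 + X * Ψ p (up 0) := by
  simp only [Ψ, pol, polUt, polUp_zero, polU0, pB, pC, pE]
  linear_combination huD

/-- U-turn run: `Ψ (ut (i+1)) = 1 + X Ψ (ut i)`. [cite: Stanley2012EC1, §4.7] -/
theorem Ψ_ut_succ (i : ℕ) : Ψ p (ut (i + 1)) = 1 + X * Ψ p (ut i) := by
  simp only [Ψ, pol, polUt, pB, pC, pE]
  linear_combination huD

/-- First rung taken at the start: two headings. [cite: Stanley2012EC1, §4.7] -/
theorem Ψ_rg1_zero : Ψ p (rg1 0) = 1 + X * (2 • Ψ p (fwd 0)) := by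
  simp only [Ψ, pol, polRg1, polFwd, polFwdLike, polF1, D, pA, pB, pC, pE, N6, nsmul_eq_mul, Nat.cast_ofNat]
  linear_combination huD

/-- First rung after a run of length `j+1`: forward or U-turn. [cite: Stanley2012EC1, §4.7] -/
theorem Ψ_rg1_succ (j : ℕ) : Ψ p (rg1 (j + 1)) = 1 + X * (Ψ p (fwd 0) + Ψ p (ut j)) := by
  simp only [Ψ, pol, polRg1, polFwd, polUt, polFwdLike, polF1, D, pA, pB, pC, pE, N6]
  linear_combination huD

/-- Initial run, rung column even: rung allowed. [cite: Stanley2012EC1, §4.7] -/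
theorem Ψ_ini_of_even (k : ℕ) (h : (p + k + 1) % 2 = 0) :
    Ψ p (ini k) = 1 + X * (Ψ p (ini (k + 1)) + Ψ p (rg1 (k + 1))) := by
  have h' : (p + (k + 1) + 1) % 2 = 1 := by omega
  simp only [Ψ, pol, polIni, polRg1, polUt, polU0, h, h', polF1, D, pA, pB, pC, pE, N6]
  linear_combination huD

/-- Initial run, odd column: no rung. [cite: Stanley2012EC1, §4.7] -/
theorem Ψ_ini_of_odd (k : ℕ) (h : (p + k + 1) % 2 = 1) :
    Ψ p (ini k) = 1 + X * Ψ p (ini (k + 1)) := by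
  have h' : (p + (k + 1) + 1) % 2 = 0 := by omega
  simp only [Ψ, pol, polIni, h, h', pB, pC, pE, N6]
  linear_combination huD

/-- Start at an even column: two horizontal moves and a rung. [cite: Stanley2012EC1, §4.7] -/
theorem Ψ_start_of_even (h : p % 2 = 0) :
    Ψ p start = 1 + X * (2 • Ψ p (ini 0) + Ψ p (rg1 0)) := by
  have he : Even p := Nat.even_iff.2 h
  have h1 : (p + 0 + 1) % 2 = 1 := by omega
  simp only [Ψ, pol, polStart, polIni, polRg1, if_pos he, h1, polF1, D, pA, pB, pC, pE, N6, nsmul_eq_mul,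
    Nat.cast_ofNat]
  linear_combination huD

/-- Start at an odd column: two horizontal moves. [cite: Stanley2012EC1, §4.7] -/
theorem Ψ_start_of_odd (h : p % 2 = 1) :
    Ψ p start = 1 + X * (2 • Ψ p (ini 0)) := by
  have he : ¬ Even p := by rw [Nat.even_iff]; omega
  have h1 : (p + 0 + 1) % 2 = 0 := by omega
  simp only [Ψ, pol, polStart, polIni, if_neg he, h1, D, pA, pB, pC, pE, N6, nsmul_eq_mul,
    Nat.cast_ofNat, add_zero]
  linear_combination huD

/-- ★ **All one-step identities at once: `Ψ p s = 1 + X · stepSum p (Ψ p) s`.**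
[cite: Stanley2012EC1, §4.7 (transfer-matrix method, Theorem 4.7.2)] -/
theorem Ψ_eq_one_add_X_mul_stepSum (s : LState) : Ψ p s = 1 + X * stepSum p (Ψ p) s := by
  rcases s with _ | k | (_ | j) | (_ | i) | k | k | (_ | j) | (_ | j)
  · -- start
    rcases Nat.mod_two_eq_zero_or_one p with h | h
    · rw [Ψ_start_of_even p h, stepSum, if_pos (Nat.even_iff.2 h)]
    · rw [Ψ_start_of_odd p h, stepSum, if_neg (by rw [Nat.even_iff]; omega), add_zero]
  · -- ini k
    rcases Nat.mod_two_eq_zero_or_one (p + k + 1) with h | h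
    · rw [Ψ_ini_of_even p k h, stepSum, if_pos (Nat.even_iff.2 h)]
    · rw [Ψ_ini_of_odd p k h, stepSum, if_neg (by rw [Nat.even_iff]; omega), add_zero]
  · rw [Ψ_rg1_zero, stepSum]
  · rw [Ψ_rg1_succ, stepSum]
  · rw [Ψ_ut_zero, stepSum]
  · rw [Ψ_ut_succ, stepSum]
  · -- up k
    rcases Nat.mod_two_eq_zero_or_one (p + k + 1) with h | h
    · rw [Ψ_up_of_even p k h, stepSum, if_pos (Nat.even_iff.2 h)]
    · rw [Ψ_up_of_odd p k h, stepSum, if_neg (by rw [Nat.even_iff]; omega), add_zero]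
  · -- fwd k
    obtain ⟨i, rfl | rfl⟩ := Nat.even_or_odd' k
    · rw [Ψ_fwd_even, stepSum, if_neg (by rw [Nat.even_iff]; omega), add_zero]
    · rw [Ψ_fwd_odd, stepSum, if_pos (Nat.even_iff.2 (by omega))]
  · rw [Ψ_rg2_zero, stepSum]
  · rw [Ψ_rg2_succ, stepSum]
  · rw [Ψ_cor_zero, stepSum]
  · rw [Ψ_cor_succ, stepSum]

end identities

/-! ## §4 The state series are the closed forms -/

/-- Every numerator has constant coefficient `1` (so every state series starts `1 + …`). [cite: Stanley2012EC1, §4.7] -/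
theorem constantCoeff_pol (p : ℕ) (s : LState) : constantCoeff (pol p s) = 1 := by
  rcases s with _ | k | (_ | j) | (_ | i) | k | k | (_ | j) | (_ | j) <;>
    simp [pol, polStart, polIni, polRg1, polUt, polU0, polV0, polUp, polFwd, polRg2, polCor, polFwdLike, polF1, D, pA, pB,
      pC, pE, N6, apply_ite constantCoeff]

/-- `coeff 0 (Ψ p s) = 1`. [cite: Stanley2012EC1, §4.7] -/
theorem coeff_zero_Ψ (p : ℕ) (s : LState) : coeff 0 (Ψ p s) = 1 := by
  rw [coeff_zero_eq_constantCoeff_apply, Ψ, map_mul, constantCoeff_pol, constantCoeff_uD, mul_one]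

/-- `coeff (m+1) (Ψ p s) = stepSum p (coeff m ∘ Ψ p) s`. [cite: Stanley2012EC1, §4.7] -/
theorem coeff_succ_Ψ (p : ℕ) (s : LState) (m : ℕ) :
    coeff (m + 1) (Ψ p s) = stepSum p (fun t => coeff m (Ψ p t)) s := by
  rw [Ψ_eq_one_add_X_mul_stepSum p s, map_add, coeff_one, if_neg (Nat.succ_ne_zero m), zero_add,
    coeff_succ_X_mul]
  exact map_stepSum (coeff m).toAddMonoidHom p (Ψ p) s

/-- ★★ **The state series are the closed forms**: `W p s m = [X^m] (pol p s · D⁻¹)` for every state `s` and every `m`.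
[cite: Stanley2012EC1, §4.7 (transfer-matrix method, Theorem 4.7.2); AlmJanson1990, §2] -/
theorem coeff_Ψ_eq_W (p : ℕ) (m : ℕ) (s : LState) : coeff m (Ψ p s) = (W p s m : ℤ) := by
  induction m generalizing s with
  | zero => rw [coeff_zero_Ψ, W_zero, Nat.cast_one]
  | succ m ih =>
    rw [coeff_succ_Ψ, W_succ]
    rw [show ((stepSum p (fun t => W p t m) s : ℕ) : ℤ) = stepSum p (fun t => ((W p t m : ℕ) : ℤ)) s from
      map_stepSum (Nat.castAddMonoidHom ℤ) p _ s]
    exact congrArg (fun f => stepSum p f s) (funext ih)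

/-- ★★ **`Σ_m W p s m X^m = pol p s · D⁻¹`.** [cite: Stanley2012EC1, §4.7 (Theorem 4.7.2); AlmJanson1990, §2] -/
theorem mk_W_eq_Ψ (p : ℕ) (s : LState) : PowerSeries.mk (fun m => (W p s m : ℤ)) = Ψ p s := by
  ext m; rw [coeff_mk, coeff_Ψ_eq_W]

/-! ## §5 The walk series of the strip -/

/-- The numerator `P(x) = 4 + 10x + 12x² + 10x³ + 2x⁴ − 4x⁵ − 12x⁶ − 12x⁷ + 6x⁹ + 2x¹¹ + 2x¹²` of the walk series of `S_1`.
[cite: BeatonBousquetMelouDeGierDuminilCopinGuttmann2014, §3.2 (arXiv v5 p. 12: the strip series are rational)] -/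
def walkP : ℤ⟦X⟧ :=
  4 + 10 * X + 12 * X ^ 2 + 10 * X ^ 3 + 2 * X ^ 4 - 4 * X ^ 5 - 12 * X ^ 6 - 12 * X ^ 7 + 6 * X ^ 9 +
    2 * X ^ 11 + 2 * X ^ 12

/-- ★★★ **The walk series of the one-cell honeycomb strip is rational:**
`(Σ_N walkCount N · X^N) · (1 − X² − X³)(1 − X⁴)² = P(X)`, i.e.
`Σ_N c_N X^N = (4 + 10x + 12x² + 10x³ + 2x⁴ − 4x⁵ − 12x⁶ − 12x⁷ + 6x⁹ + 2x¹¹ + 2x¹²)/((1 − x² − x³)(1 − x⁴)²)` for the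
automaton count `walkCount` (identified with `c_N(S_1)` in the sequel).
[cite: BeatonBousquetMelouDeGierDuminilCopinGuttmann2014, §3.2 (arXiv v5 p. 12); Stanley2012EC1, §4.7 (Theorem 4.7.2);
AlmJanson1990, §2] -/
theorem walkCount_series :
    PowerSeries.mk (fun N => (walkCount N : ℤ)) * ((1 - X ^ 2 - X ^ 3) * (1 - X ^ 4) ^ 2) = walkP := by
  have hmk : PowerSeries.mk (fun N => (walkCount N : ℤ)) = 2 • (Ψ 0 start + Ψ 1 start) := by
    ext N
    rw [coeff_mk, map_nsmul, map_add, coeff_Ψ_eq_W, coeff_Ψ_eq_W, walkCount, nsmul_eq_mul]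
    push_cast
    ring
  have e0 : Even 0 := ⟨0, rfl⟩
  have e1 : ¬ Even 1 := by decide
  rw [hmk, nsmul_eq_mul, Nat.cast_ofNat]
  simp only [Ψ, pol, polStart, polIni, polRg1, polV0, polF1, D, pA, pB, pC, pE, N6, walkP, if_pos e0,
    if_neg e1, add_zero, Nat.zero_add, Nat.reduceMod, Nat.reduceAdd, Nat.reduceMul]
  linear_combination (4 + 10 * X + 12 * X ^ 2 + 10 * X ^ 3 + 2 * X ^ 4 - 4 * X ^ 5 - 12 * X ^ 6 - 12 * X ^ 7 +
    6 * X ^ 9 + 2 * X ^ 11 + 2 * X ^ 12 : ℤ⟦X⟧) * huD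

/-- Coefficients of `P` vanish from degree `13` on. [cite: Stanley2012EC1, §4.1 (Theorem 4.1.1)] -/
theorem coeff_walkP_eq_zero (n : ℕ) : coeff (n + 13) walkP = 0 := by
  simp only [walkP, ← map_ofNat PowerSeries.C, map_add, map_sub, PowerSeries.coeff_C_mul, PowerSeries.coeff_X_pow,
    PowerSeries.coeff_C, PowerSeries.coeff_X, Nat.reduceEqDiff, if_false, mul_zero, add_zero, sub_zero]

/-- `[X^{d+k}] (Σ f_N X^N) · X^k = f_d`. [cite: Stanley2012EC1, §4.1] -/
theorem coeff_add_mk_mul_X_pow (f : ℕ → ℤ) (d k : ℕ) : coeff (d + k) (PowerSeries.mk f * X ^ k) = f d := by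
  rw [PowerSeries.coeff_mul_X_pow, coeff_mk]

/-- ★ **The linear recurrence** (order 11): for every `n`,
`c_{n+13} = c_{n+11} + c_{n+10} + 2c_{n+9} − 2c_{n+7} − 2c_{n+6} − c_{n+5} + c_{n+3} + c_{n+2}`
(`c = walkCount`; i.e. `c_N = c_{N−2} + c_{N−3} + 2c_{N−4} − 2c_{N−6} − 2c_{N−7} − c_{N−8} + c_{N−10} + c_{N−11}`, `N ≥ 13`).
[cite: Stanley2012EC1, §4.1 (Theorem 4.1.1: rational series ⟺ linear recurrence)] -/
theorem walkCount_rec (n : ℕ) :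
    (walkCount (n + 13) : ℤ) = walkCount (n + 11) + walkCount (n + 10) + 2 * walkCount (n + 9)
      - 2 * walkCount (n + 7) - 2 * walkCount (n + 6) - walkCount (n + 5) + walkCount (n + 3)
      + walkCount (n + 2) := by
  set f : ℕ → ℤ := fun N => (walkCount N : ℤ) with hf
  have h := congrArg (coeff (n + 13)) walkCount_series
  have hQ : ((1 - X ^ 2 - X ^ 3) * (1 - X ^ 4) ^ 2 : ℤ⟦X⟧) =
      1 - X ^ 2 - X ^ 3 - X ^ 4 - X ^ 4 + X ^ 6 + X ^ 6 + X ^ 7 + X ^ 7 + X ^ 8 - X ^ 10 - X ^ 11 := by ring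
  rw [hQ, coeff_walkP_eq_zero] at h
  simp only [mul_sub, mul_add, mul_one, map_sub, map_add, coeff_mk] at h
  rw [coeff_add_mk_mul_X_pow f (n + 11) 2, coeff_add_mk_mul_X_pow f (n + 10) 3, coeff_add_mk_mul_X_pow f (n + 9) 4,
    coeff_add_mk_mul_X_pow f (n + 7) 6, coeff_add_mk_mul_X_pow f (n + 6) 7, coeff_add_mk_mul_X_pow f (n + 5) 8,
    coeff_add_mk_mul_X_pow f (n + 3) 10, coeff_add_mk_mul_X_pow f (n + 2) 11] at h
  simp only [hf] at h
  linear_combination h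


/-! ## §6 Words placed in the strip: visited sites, the `Good` predicate, one more letter -/

section words

/-- The site with coordinates `(cx, cy)` is visited by the word `w` placed at `a` (at some time `i ≤ |w|`).
[cite: MadrasSlade1993, §1.1 (walks as step sequences)] -/
def VisAt (a : Site 2) (w : List Step) (cx cy : ℤ) : Prop := ∃ i ≤ w.length, (a + traj w i) 0 = cx ∧ (a + traj w i) 1 = cy

/-- **`Good a w`**: the word `w` placed at `a` is a self-avoiding walk of the brick wall staying in the strip `S_1`
(the three conditions of `HexBW.stripPairs 1` on the pair `(a, traj w)`). [cite: MadrasSlade1993, §8.2, eq. (8.2.1)] -/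
def Good (a : Site 2) (w : List Step) : Prop :=
  IsSAW w ∧ (∀ i < w.length, brickWallGraph.Adj (a + traj w i) (a + traj w (i + 1))) ∧
    ∀ i ≤ w.length, InStrip 1 (a + traj w i)

variable {a : Site 2} {w : List Step}

/-- The start is visited. [cite: MadrasSlade1993, §1.1] -/
theorem visAt_start : VisAt a w (a 0) (a 1) := ⟨0, Nat.zero_le _, by simp, by simp⟩

/-- The current endpoint is visited. [cite: MadrasSlade1993, §1.1] -/
theorem visAt_end : VisAt a w ((a + wEnd w) 0) ((a + wEnd w) 1) :=
  ⟨w.length, le_rfl, by rw [traj_length], by rw [traj_length]⟩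

/-- Visited sites after one more letter: the old ones and the new endpoint. [cite: MadrasSlade1993, §1.1] -/
theorem visAt_snoc_iff (ℓ : Step) (cx cy : ℤ) :
    VisAt a (w ++ [ℓ]) cx cy ↔
      VisAt a w cx cy ∨ ((a + wEnd w) 0 + Step.dx ℓ = cx ∧ (a + wEnd w) 1 + Step.dy ℓ = cy) := by
  constructor
  · rintro ⟨i, hi, h0, h1⟩
    rw [List.length_append, List.length_singleton] at hi
    rcases Nat.lt_or_ge i (w.length + 1) with hlt | hge
    · left
      refine ⟨i, by omega, ?_, ?_⟩ <;> [rw [← h0]; rw [← h1]] <;> rw [traj_append_left _ _ (by omega)]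
    · right
      have hi' : i = w.length + 1 := by omega
      subst hi'
      rw [traj_append_right w [ℓ] 1, show traj [ℓ] 1 = Step.vec ℓ by simp [traj]] at h0 h1
      simp only [Pi.add_apply, Step.vec_apply_zero, Step.vec_apply_one] at h0 h1
      constructor <;> [rw [← h0]; rw [← h1]] <;> simp [add_assoc]
  · rintro (⟨i, hi, h0, h1⟩ | ⟨h0, h1⟩)
    · exact ⟨i, by rw [List.length_append]; omega, by rw [traj_append_left _ _ hi]; exact h0,
        by rw [traj_append_left _ _ hi]; exact h1⟩
    · simp only [Pi.add_apply] at h0 h1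
      refine ⟨w.length + 1, by simp, ?_, ?_⟩ <;>
        rw [traj_append_right w [ℓ] 1, show traj [ℓ] 1 = Step.vec ℓ by simp [traj]] <;>
        simp [← add_assoc, h0, h1]

/-- `Good` for the empty word: the start lies in the strip. [cite: MadrasSlade1993, §8.2] -/
theorem good_nil (ha : InStrip 1 a) : Good a [] := by
  refine ⟨isSAW_nil, fun i hi => absurd hi (Nat.not_lt_zero i), fun i hi => ?_⟩
  have : i = 0 := by simpa using hi
  subst this; simpa using ha

/-- **One more letter**: `w ++ [ℓ]` is good iff `w` is good, the new site is fresh, the new bond is a brick-wall bond and the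
new site is in the strip. [cite: MadrasSlade1993, §1.1, §8.2] -/
theorem good_snoc_iff (ℓ : Step) :
    Good a (w ++ [ℓ]) ↔
      Good a w ∧ ¬ VisAt a w ((a + wEnd w) 0 + Step.dx ℓ) ((a + wEnd w) 1 + Step.dy ℓ) ∧
        brickWallGraph.Adj (a + wEnd w) (a + wEnd w + Step.vec ℓ) ∧ InStrip 1 (a + wEnd w + Step.vec ℓ) := by
  have hlen : (w ++ [ℓ]).length = w.length + 1 := by simp
  have hlast : traj (w ++ [ℓ]) (w.length + 1) = wEnd w + Step.vec ℓ := by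
    rw [traj_append_right w [ℓ] 1, show traj [ℓ] 1 = Step.vec ℓ by simp [traj]]
  have hleft : ∀ i ≤ w.length, traj (w ++ [ℓ]) i = traj w i := fun i hi => traj_append_left _ _ hi
  constructor
  · rintro ⟨hs, hb, hin⟩
    have hs' : IsSAW w := by simpa using hs.take w.length
    refine ⟨⟨hs', fun i hi => ?_, fun i hi => ?_⟩, ?_, ?_, ?_⟩
    · have := hb i (by rw [hlen]; omega)
      rwa [hleft i hi.le, hleft (i + 1) hi] at this
    · have := hin i (by rw [hlen]; omega); rwa [hleft i hi] at this
    · rintro ⟨i, hi, h0, h1⟩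
      have hinj := (isSAW_iff_injOn _).1 hs
      have heq : traj (w ++ [ℓ]) i = traj (w ++ [ℓ]) (w.length + 1) := by
        rw [hleft i hi, hlast, site_two_eq_iff]
        simp only [Pi.add_apply, Step.vec_apply_zero, Step.vec_apply_one] at h0 h1 ⊢
        constructor <;> omega
      have := hinj (show i ∈ {j | j ≤ (w ++ [ℓ]).length} by simp; omega)
        (show w.length + 1 ∈ {j | j ≤ (w ++ [ℓ]).length} by simp) heq
      omega
    · have := hb w.length (by rw [hlen]; omega)
      rwa [hleft _ le_rfl, traj_length, hlast, ← add_assoc] at this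
    · have := hin (w.length + 1) (by rw [hlen])
      rwa [hlast, ← add_assoc] at this
  · rintro ⟨⟨hs, hb, hin⟩, hfresh, hadj, hstrip⟩
    refine ⟨?_, fun i hi => ?_, fun i hi => ?_⟩
    · rw [isSAW_iff_injOn] at hs ⊢
      intro i hi j hj hij
      simp only [Set.mem_setOf_eq, hlen] at hi hj
      rcases Nat.lt_or_ge i (w.length + 1) with hi' | hi' <;> rcases Nat.lt_or_ge j (w.length + 1) with hj' | hj'
      · rw [hleft i (by omega), hleft j (by omega)] at hij
        exact hs (show i ≤ w.length by omega) (show j ≤ w.length by omega) hij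
      · exfalso; apply hfresh
        obtain rfl : j = w.length + 1 := by omega
        rw [hleft i (by omega), hlast] at hij
        refine ⟨i, by omega, ?_, ?_⟩ <;> simp [hij, add_assoc]
      · exfalso; apply hfresh
        obtain rfl : i = w.length + 1 := by omega
        rw [hleft j (by omega), hlast] at hij
        refine ⟨j, by omega, ?_, ?_⟩ <;> simp [← hij, add_assoc]
      · omega
    · rw [hlen] at hi
      rcases Nat.lt_or_ge i w.length with hi' | hi'
      · rw [hleft i hi'.le, hleft (i + 1) hi']; exact hb i hi'
      · obtain rfl : i = w.length := by omega
        rw [hleft _ le_rfl, traj_length, hlast, ← add_assoc]; exact hadj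
    · rw [hlen] at hi
      rcases Nat.lt_or_ge i (w.length + 1) with hi' | hi'
      · rw [hleft i (by omega)]; exact hin i (by omega)
      · obtain rfl : i = w.length + 1 := by omega
        rw [hlast, ← add_assoc]; exact hstrip

/-- **The pairs of `HexBW.stripPairs 1 N` are the good words**: `(a, traj w) ∈ stripPairs 1 |w| ↔ a ∈ stripStarts 1 ∧ Good a w`.
[cite: MadrasSlade1993, §8.2, eq. (8.2.1)] -/
theorem mem_stripPairs_iff_good : (a, traj w) ∈ stripPairs 1 w.length ↔ a ∈ stripStarts 1 ∧ Good a w := by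
  rw [mem_stripPairs]
  constructor
  · rintro ⟨ha, hω, hbw, hin⟩
    refine ⟨ha, ?_, fun i hi => hbw i hi, hin⟩
    rw [isSAW_iff_injOn]; exact (Zd.mem_saws.1 hω).2.2.2
  · rintro ⟨ha, hs, hb, hin⟩
    exact ⟨ha, traj_mem_saws rfl hs, fun i hi => hb i hi, hin⟩

end words


/-! ## §7 The geometric automaton on step words (with heading and row) -/

/-- A geometric state: the abstract state, the current heading `h ∈ {+1, −1}` (`0` before the first horizontal step), and the
current row `r ∈ {0, 1}`. [cite: Stanley2012EC1, §4.7 (transfer-matrix method)] -/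
structure GState where
  /-- the abstract state -/
  s : LState
  /-- the heading (`0` = none yet) -/
  h : ℤ
  /-- the current row -/
  r : ℤ
  deriving DecidableEq

/-- Successor under a horizontal step in the current (or a fresh) heading. [cite: Stanley2012EC1, §4.7] -/
def fwdT : LState → Option LState
  | start => some (ini 0)
  | ini k => some (ini (k + 1))
  | rg1 _ => some (fwd 0)
  | ut 0 => some (up 0)
  | ut (i + 1) => some (ut i)
  | up k => some (up (k + 1))
  | fwd k => some (fwd (k + 1))
  | rg2 _ => some (fwd 0)
  | cor 0 => none
  | cor (j + 1) => some (cor j)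

/-- Successor under a horizontal step AGAINST the current heading (a reversal). [cite: Stanley2012EC1, §4.7] -/
def backT : LState → Option LState
  | rg1 (j + 1) => some (ut j)
  | rg2 (j + 1) => some (cor j)
  | _ => none

/-- Successor under a rung (start-column parity `p`). [cite: Stanley2012EC1, §4.7] -/
def rungT (p : ℕ) : LState → Option LState
  | start => if Even p then some (rg1 0) else none
  | ini k => if Even (p + k + 1) then some (rg1 (k + 1)) else none
  | up k => if Even (p + k + 1) then some (rg2 k) else none
  | fwd k => if Even (k + 1) then some (rg2 k) else none
  | _ => none

/-- **The transition function on letters** (`Step = Fin 4`: `0 ↦ +e₀`, `1 ↦ +e₁`, `2 ↦ −e₀`, `3 ↦ −e₁`): a horizontal letter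
against a defined heading is a reversal (`backT`), any other horizontal letter is forward (`fwdT`) and sets the heading; the
vertical letter towards the other row is a rung (`rungT`), the one leaving the strip is rejected.
[cite: Stanley2012EC1, §4.7 (transfer-matrix method)] -/
def δ (p : ℕ) (g : GState) (ℓ : Step) : Option GState :=
  if Step.dy ℓ = 0 then
    (if g.h ≠ 0 ∧ Step.dx ℓ = -g.h then backT g.s else fwdT g.s).map fun s' => ⟨s', Step.dx ℓ, g.r⟩
  else if Step.dy ℓ = 1 - 2 * g.r then (rungT p g.s).map fun s' => ⟨s', g.h, 1 - g.r⟩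
  else none

/-- **Running the automaton on a word** (left to right); `none` = rejected. [cite: Stanley2012EC1, §4.7] -/
def run (p : ℕ) (g : GState) (w : List Step) : Option GState :=
  w.foldl (fun og ℓ => og.bind fun g' => δ p g' ℓ) (some g)

/-- The starting configuration at the site `a`: no step, no heading, row `a 1`. [cite: MadrasSlade1993, §8.2, eq. (8.2.1)] -/
def startG (a : Site 2) : GState := ⟨start, 0, a 1⟩

section run

variable (p : ℕ) (g : GState)

/-- `run` on the empty word. [cite: Stanley2012EC1, §4.7] -/
@[simp] theorem run_nil : run p g [] = some g := rfl

/-- Once rejected, always rejected. [folklore] -/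
private theorem foldl_none (w : List Step) :
    w.foldl (fun og ℓ => og.bind fun g' => δ p g' ℓ) none = none := by
  induction w with
  | nil => rfl
  | cons ℓ w ih => exact ih

/-- `run` on `ℓ :: w`: one transition, then the rest. [cite: Stanley2012EC1, §4.7] -/
theorem run_cons (ℓ : Step) (w : List Step) : run p g (ℓ :: w) = (δ p g ℓ).bind fun g' => run p g' w := by
  rw [run, List.foldl_cons, Option.bind]
  cases hδ : δ p g ℓ with
  | none => exact foldl_none p w
  | some g' => rfl

/-- `run` on `w ++ [ℓ]`: the run on `w`, then one transition. [cite: Stanley2012EC1, §4.7] -/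
theorem run_snoc (w : List Step) (ℓ : Step) : run p g (w ++ [ℓ]) = (run p g w).bind fun g' => δ p g' ℓ := by
  rw [run, List.foldl_append, List.foldl_cons, List.foldl_nil]; rfl

end run

/-! ### Counting accepted words -/

/-- Heading bookkeeping: no heading exactly in the states `start` and `rg1 0`, otherwise `h = ±1`.
[cite: Stanley2012EC1, §4.7] -/
def HOk (g : GState) : Prop :=
  match g.s with
  | start => g.h = 0
  | rg1 0 => g.h = 0
  | _ => g.h = 1 ∨ g.h = -1

/-- The accepted words of length `m` from `g`. [cite: Stanley2012EC1, §4.7] -/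
def acc (p : ℕ) (g : GState) (m : ℕ) : Finset (List Step) := (words m).filter fun w => (run p g w).isSome

/-- The words of length `m + 1` are the `ℓ :: w`, `w` of length `m`. [cite: MadrasSlade1993, §1.1 (walks as step sequences)] -/
theorem words_succ (m : ℕ) : words (m + 1) = (Finset.univ ×ˢ words m).image fun q => q.1 :: q.2 := by
  ext w
  simp only [mem_words, Finset.mem_image, Finset.mem_product, Finset.mem_univ, true_and, Prod.exists]
  constructor
  · intro h
    cases w with
    | nil => simp at h
    | cons ℓ w => exact ⟨ℓ, w, by simpa using h, rfl⟩
  · rintro ⟨ℓ, w', hw', rfl⟩; simpa using hw'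

/-- One letter at a time: `#acc (m+1)` is the sum over the first letter. [cite: Stanley2012EC1, §4.7] -/
theorem card_acc_succ (p : ℕ) (g : GState) (m : ℕ) :
    (acc p g (m + 1)).card = ∑ ℓ : Step, ((δ p g ℓ).elim 0 fun g' => (acc p g' m).card) := by
  classical
  have hinj : Function.Injective (fun q : Step × List Step => q.1 :: q.2) := by
    rintro ⟨a, b⟩ ⟨c, d⟩ h; simpa using h
  rw [acc, words_succ, Finset.filter_image, Finset.card_image_of_injective _ hinj, Finset.card_filter,
    Finset.sum_product]
  refine Finset.sum_congr rfl fun ℓ _ => ?_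
  rw [show (∑ w ∈ words m, if (run p g (ℓ :: w)).isSome = true then 1 else 0) =
      ∑ w ∈ words m, if ((δ p g ℓ).bind fun g' => run p g' w).isSome = true then 1 else 0 from
    Finset.sum_congr rfl fun w _ => by rw [run_cons]]
  cases δ p g ℓ with
  | none => simp
  | some g' => rw [Option.elim, acc, Finset.card_filter]; rfl

/-- `Option.elim` through an `if`. [folklore] -/
private theorem elim_ite {α β : Type*} (c : Prop) [Decidable c] (x : α) (b : β) (f : α → β) :
    (if c then some x else none).elim b f = if c then f x else b := by
  split_ifs <;> rfl

/-- **The accepted words are counted by `W`**: `#acc p g m = W p g.s m` whenever the heading and row are well formed.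
[cite: Stanley2012EC1, §4.7 (transfer-matrix method, Theorem 4.7.2)] -/
theorem card_acc (p : ℕ) (m : ℕ) (g : GState) (hg : HOk g) (hr : g.r = 0 ∨ g.r = 1) : (acc p g m).card = W p g.s m := by
  induction m generalizing g with
  | zero =>
    rw [W_zero, acc, Finset.card_eq_one]
    refine ⟨[], ?_⟩
    ext w; simp only [Finset.mem_filter, mem_words, List.length_eq_zero_iff, Finset.mem_singleton]
    constructor
    · exact fun h => h.1
    · rintro rfl; exact ⟨rfl, by simp⟩
  | succ m ih =>
    rw [card_acc_succ, Fin.sum_univ_four, W_succ]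
    obtain ⟨s, h, r⟩ := g
    simp only at hr
    rcases hr with rfl | rfl <;>
    rcases s with _ | k | (_ | j) | (_ | i) | k | k | (_ | j) | (_ | j) <;>
    simp only [HOk] at hg <;>
    rcases hg with rfl | rfl | rfl <;>
    simp [δ, fwdT, backT, rungT, Step.dx, Step.dy, stepSum, ih, HOk, elim_ite, two_mul] <;> ring



/-! ## §8 The phase invariants (arithmetic form) and the one-letter analysis

The visited set is abstracted to a predicate `V : ℤ → ℤ → Prop` on coordinates; `x0, r0` are the starting column and row, `x`
the current column, and the current row is the automaton's `r`.  For each state the invariant lists what the future needs to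
know about `V`. -/

/-- **The invariant of a state**, on coordinates. [cite: Stanley2012EC1, §4.7 (transfer-matrix method)] -/
def InvS (x0 r0 x : ℤ) (V : ℤ → ℤ → Prop) : LState → ℤ → ℤ → Prop
  | start, h, r => h = 0 ∧ r = r0 ∧ x = x0 ∧ V x0 r0 ∧ ∀ cx cy, V cx cy → cx = x0 ∧ cy = r0
  | ini k, h, r => (h = 1 ∨ h = -1) ∧ r = r0 ∧ x = x0 + h * (k + 1) ∧
      (∀ cx cy, V cx cy → cy = r0 ∧ 0 ≤ h * (cx - x0) ∧ h * (cx - x0) ≤ k + 1) ∧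
      ∀ j : ℤ, 0 ≤ j → j ≤ k + 1 → V (x0 + h * j) r0
  | rg1 A, h, r => r = 1 - r0 ∧ x = x0 + h * A ∧ (A = 0 → h = 0) ∧ (A ≠ 0 → h = 1 ∨ h = -1) ∧ x % 2 = 0 ∧
      (∀ cx cy, V cx cy → (cx = x ∧ cy = r) ∨ (cy = r0 ∧ 0 ≤ h * (cx - x0) ∧ h * (cx - x0) ≤ A ∧ (A = 0 → cx = x0))) ∧
      ∀ j : ℤ, 0 ≤ j → j ≤ A → V (x0 + h * j) r0
  | ut i, h, r => (h = 1 ∨ h = -1) ∧ r = 1 - r0 ∧ x = x0 - h * i ∧ ∃ A : ℕ, i + 1 ≤ A ∧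
      (∀ j : ℤ, 0 ≤ j → j ≤ A → V (x0 - h * j) r0) ∧ (∀ j : ℤ, (i : ℤ) ≤ j → j ≤ A → V (x0 - h * j) (1 - r0)) ∧
      ∀ cx cy, V cx cy → (cy = r0 ∧ 0 ≤ -(h * (cx - x0)) ∧ -(h * (cx - x0)) ≤ A) ∨
        (cy = 1 - r0 ∧ (i : ℤ) ≤ -(h * (cx - x0)) ∧ -(h * (cx - x0)) ≤ A)
  | up k, h, r => (h = 1 ∨ h = -1) ∧ r = 1 - r0 ∧ x = x0 + h * (k + 1) ∧ V x0 r0 ∧ ∃ A : ℕ,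
      (∀ j : ℤ, -(k + 1 : ℤ) ≤ j → j ≤ A → V (x0 - h * j) (1 - r0)) ∧
      ∀ cx cy, V cx cy → (cy = r0 ∧ 0 ≤ -(h * (cx - x0)) ∧ -(h * (cx - x0)) ≤ A) ∨
        (cy = 1 - r0 ∧ -(k + 1 : ℤ) ≤ -(h * (cx - x0)) ∧ -(h * (cx - x0)) ≤ A)
  | fwd k, h, r => (h = 1 ∨ h = -1) ∧ (x - h * (k + 1)) % 2 = 0 ∧
      (∀ cx cy, V cx cy → (cx = x ∧ cy = r) ∨ h * cx ≤ h * x - 1) ∧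
      (∀ cx cy, V cx cy → cy = 1 - r → h * cx ≤ h * (x - h * (k + 1))) ∧
      V (x - h * (k + 1)) (1 - r) ∧ ∀ j : ℤ, 0 ≤ j → j ≤ k + 1 → V (x - h * j) r
  | rg2 k, h, r => (h = 1 ∨ h = -1) ∧ x % 2 = 0 ∧ (∀ cx cy, V cx cy → h * cx ≤ h * x) ∧
      (∀ cx cy, V cx cy → cy = r → cx = x ∨ h * cx ≤ h * (x - h * (k + 1))) ∧
      V (x - h * (k + 1)) r ∧ ∀ j : ℤ, 0 ≤ j → j ≤ k + 1 → V (x - h * j) (1 - r)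
  | cor j, h, r => (h = 1 ∨ h = -1) ∧ (∀ i : ℤ, 1 ≤ i → i ≤ j → ¬ V (x + h * i) r) ∧ V (x + h * (j + 1)) r ∧
      (∀ i : ℤ, 0 ≤ i → i ≤ j → V (x + h * i) (1 - r)) ∧ V (x - h) r

section steps

variable {p : ℕ} {x0 r0 x : ℤ} {V : ℤ → ℤ → Prop} {h r h' r' : ℤ} {ℓ : Step} {s' : LState}

/-- The visited predicate after one more letter. [cite: MadrasSlade1993, §1.1] -/
def V' (V : ℤ → ℤ → Prop) (nx ny : ℤ) : ℤ → ℤ → Prop := fun cx cy => V cx cy ∨ (cx = nx ∧ cy = ny)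

/-- What one letter must satisfy for the walk to stay good (fresh site, brick-wall bond, in the strip) — arithmetic form.
[cite: MadrasSlade1993, §8.2] -/
def StepOK (V : ℤ → ℤ → Prop) (x r : ℤ) (ℓ : Step) : Prop :=
  ¬ V (x + Step.dx ℓ) (r + Step.dy ℓ) ∧ (Step.dy ℓ = 0 ∨ x % 2 = 0) ∧ (r + Step.dy ℓ = 0 ∨ r + Step.dy ℓ = 1)

/-- Transport of a `V`-fact along provably equal coordinates. [folklore] -/
private theorem vcongr {V : ℤ → ℤ → Prop} {a b a' b' : ℤ} (hv : V a b) (ha : a = a') (hb : b = b') : V a' b' := by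
  subst ha hb; exact hv

/-- Each letter is horizontal (`dx = ±1`, `dy = 0`) or vertical (`dx = 0`, `dy = ±1`). [folklore] -/
private theorem step_cases (ℓ : Step) :
    (Step.dy ℓ = 0 ∧ (Step.dx ℓ = 1 ∨ Step.dx ℓ = -1)) ∨ (Step.dx ℓ = 0 ∧ (Step.dy ℓ = 1 ∨ Step.dy ℓ = -1)) := by
  fin_cases ℓ <;> simp [Step.dx, Step.dy]

/-- **Anatomy of a successful transition.** [cite: Stanley2012EC1, §4.7] -/
theorem δ_eq_some {s : LState} (hδ : δ p ⟨s, h, r⟩ ℓ = some ⟨s', h', r'⟩) :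
    (Step.dy ℓ = 0 ∧ (Step.dx ℓ = 1 ∨ Step.dx ℓ = -1) ∧ h' = Step.dx ℓ ∧ r' = r ∧
        ((h ≠ 0 ∧ Step.dx ℓ = -h ∧ backT s = some s') ∨ ((h = 0 ∨ Step.dx ℓ ≠ -h) ∧ fwdT s = some s'))) ∨
      (Step.dx ℓ = 0 ∧ Step.dy ℓ = 1 - 2 * r ∧ h' = h ∧ r' = 1 - r ∧ rungT p s = some s') := by
  unfold δ at hδ
  rcases step_cases ℓ with ⟨hdy, hdx⟩ | ⟨hdx, hdy⟩
  · left
    rw [if_pos hdy] at hδ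
    refine ⟨hdy, hdx, ?_⟩
    by_cases hb : h ≠ 0 ∧ Step.dx ℓ = -h
    · rw [if_pos hb] at hδ
      cases hB : backT s with
      | none => rw [hB] at hδ; simp at hδ
      | some t =>
        rw [hB, Option.map_some, Option.some.injEq, GState.mk.injEq] at hδ
        exact ⟨hδ.2.1.symm, hδ.2.2.symm, Or.inl ⟨hb.1, hb.2, by rw [hδ.1]⟩⟩
    · rw [if_neg hb] at hδ
      cases hF : fwdT s with
      | none => rw [hF] at hδ; simp at hδ
      | some t =>
        rw [hF, Option.map_some, Option.some.injEq, GState.mk.injEq] at hδ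
        refine ⟨hδ.2.1.symm, hδ.2.2.symm, Or.inr ⟨?_, by rw [hδ.1]⟩⟩
        by_cases h0 : h = 0
        · exact Or.inl h0
        · exact Or.inr fun hx => hb ⟨h0, hx⟩
  · right
    have hdy0 : Step.dy ℓ ≠ 0 := by omega
    rw [if_neg hdy0] at hδ
    by_cases hv : Step.dy ℓ = 1 - 2 * r
    · rw [if_pos hv] at hδ
      cases hR : rungT p s with
      | none => rw [hR] at hδ; simp at hδ
      | some t =>
        rw [hR, Option.map_some, Option.some.injEq, GState.mk.injEq] at hδ
        exact ⟨hdx, hv, hδ.2.1.symm, hδ.2.2.symm, by rw [hδ.1]⟩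
    · rw [if_neg hv] at hδ; simp at hδ

/-- **When a good letter is offered, the transition succeeds** — the generic reduction: it suffices to exhibit the successor in
each of the three move classes. [cite: Stanley2012EC1, §4.7] -/
theorem δ_isSome_of {s : LState} (hr : r = 0 ∨ r = 1)
    (hfwd : Step.dy ℓ = 0 → (h = 0 ∨ Step.dx ℓ ≠ -h) → (fwdT s).isSome)
    (hback : Step.dy ℓ = 0 → h ≠ 0 → Step.dx ℓ = -h → (backT s).isSome)
    (hrung : Step.dx ℓ = 0 → Step.dy ℓ = 1 - 2 * r → (rungT p s).isSome)
    (hstrip : r + Step.dy ℓ = 0 ∨ r + Step.dy ℓ = 1) : (δ p ⟨s, h, r⟩ ℓ).isSome := by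
  unfold δ
  rcases step_cases ℓ with ⟨hdy, hdx⟩ | ⟨hdx, hdy⟩
  · rw [if_pos hdy]
    by_cases hb : h ≠ 0 ∧ Step.dx ℓ = -h
    · rw [if_pos hb]; have := hback hdy hb.1 hb.2; rw [Option.isSome_iff_exists] at this ⊢
      obtain ⟨t, ht⟩ := this; exact ⟨_, by rw [ht]; rfl⟩
    · rw [if_neg hb]
      have := hfwd hdy (by by_cases h0 : h = 0; exact Or.inl h0; exact Or.inr fun hx => hb ⟨h0, hx⟩)
      rw [Option.isSome_iff_exists] at this ⊢
      obtain ⟨t, ht⟩ := this; exact ⟨_, by rw [ht]; rfl⟩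
  · have hdy0 : Step.dy ℓ ≠ 0 := by omega
    have hv : Step.dy ℓ = 1 - 2 * r := by omega
    rw [if_neg hdy0, if_pos hv]
    have := hrung hdx hv; rw [Option.isSome_iff_exists] at this ⊢
    obtain ⟨t, ht⟩ := this; exact ⟨_, by rw [ht]; rfl⟩

/-- The conclusion of a successful transition: the letter is good and the invariant propagates.
[cite: Stanley2012EC1, §4.7] -/
def StepConcl (x0 r0 x : ℤ) (V : ℤ → ℤ → Prop) (r : ℤ) (ℓ : Step) (s' : LState) (h' r' : ℤ) : Prop :=
  StepOK V x r ℓ ∧ r' = r + Step.dy ℓ ∧ InvS x0 r0 (x + Step.dx ℓ) (V' V (x + Step.dx ℓ) (r + Step.dy ℓ)) s' h' r'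

/-! ### `start` -/

/-- Transition from `start`. [cite: Stanley2012EC1, §4.7] -/
theorem step_start (hp : x0 = p) (hr0 : r0 = 0 ∨ r0 = 1) (hI : InvS x0 r0 x V start h r)
    (hδ : δ p ⟨start, h, r⟩ ℓ = some ⟨s', h', r'⟩) : StepConcl x0 r0 x V r ℓ s' h' r' := by
  obtain ⟨rfl, rfl, rfl, hV0, hV⟩ := hI
  rcases δ_eq_some hδ with ⟨hdy, hdx, rfl, rfl, ⟨h0, -, -⟩ | ⟨-, hs'⟩⟩ | ⟨hdx, hdy, rfl, rfl, hs'⟩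
  · exact absurd rfl h0
  · simp only [fwdT, Option.some.injEq] at hs'; subst hs'
    refine ⟨⟨fun hv => ?_, Or.inl hdy, by omega⟩, by omega, hdx, by omega, by push_cast; omega, ?_, ?_⟩
    · have := hV _ _ hv; omega
    · rintro cx cy (hv | ⟨rfl, rfl⟩)
      · have := hV _ _ hv; rcases hdx with hdx | hdx <;> rw [hdx] <;> constructor <;> omega
      · rcases hdx with hdx | hdx <;> rw [hdx] <;> push_cast <;> constructor <;> omega
    · intro j hj0 hj1
      rcases (show j = 0 ∨ j = 1 by push_cast at hj1; omega) with rfl | rfl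
      · exact Or.inl (vcongr hV0 (by ring) (by omega))
      · exact Or.inr ⟨by ring, by omega⟩
  · simp only [rungT] at hs'
    by_cases he : Even p
    · rw [if_pos he, Option.some.injEq] at hs'; subst hs'
      rw [Nat.even_iff] at he
      refine ⟨⟨fun hv => ?_, Or.inr (by omega), by omega⟩, by omega, by omega, by rw [hdx]; ring, fun _ => rfl,
        fun h0 => absurd rfl h0, by omega, ?_, ?_⟩
      · have := hV _ _ hv; omega
      · rintro cx cy (hv | ⟨rfl, rfl⟩)
        · right; have := hV _ _ hv; refine ⟨this.2, by omega, by omega, fun _ => this.1⟩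
        · left; exact ⟨rfl, by omega⟩
      · intro j hj0 hj1
        exact Or.inl (vcongr hV0 (by push_cast at hj1; nlinarith) (by omega))
    · rw [if_neg he] at hs'; exact absurd hs' (by simp)

/-- Blocking at `start`. [cite: Stanley2012EC1, §4.7] -/
theorem block_start (hp : x0 = p) (hr0 : r0 = 0 ∨ r0 = 1) (hI : InvS x0 r0 x V start h r)
    (hOK : StepOK V x r ℓ) : (δ p ⟨start, h, r⟩ ℓ).isSome := by
  obtain ⟨rfl, rfl, rfl, hV0, hV⟩ := hI
  obtain ⟨hfresh, hbond, hstrip⟩ := hOK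
  refine δ_isSome_of hr0 (fun _ _ => by simp [fwdT]) (fun _ h0 _ => absurd rfl h0) (fun hdx hdy => ?_) hstrip
  have he : Even p := by rw [Nat.even_iff]; rcases hbond with h0 | h0 <;> omega
  simp [rungT, he]

/-! ### `ini k` -/

/-- Transition from `ini k`. [cite: Stanley2012EC1, §4.7] -/
theorem step_ini {k : ℕ} (hp : x0 = p) (hr0 : r0 = 0 ∨ r0 = 1) (hI : InvS x0 r0 x V (ini k) h r)
    (hδ : δ p ⟨ini k, h, r⟩ ℓ = some ⟨s', h', r'⟩) : StepConcl x0 r0 x V r ℓ s' h' r' := by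
  obtain ⟨hh, rfl, hx, hV, hrun⟩ := hI
  rcases δ_eq_some hδ with ⟨hdy, hdx, rfl, rfl, ⟨-, -, hs⟩ | ⟨h01, hs⟩⟩ | ⟨hdx, hdy, rfl, rfl, hs⟩
  · simp [backT] at hs
  · simp only [fwdT, Option.some.injEq] at hs; subst hs
    have hdxh : Step.dx ℓ = h := by rcases hh with rfl | rfl <;> omega
    rw [StepConcl, hdxh]
    rcases hh with rfl | rfl
    all_goals
      refine ⟨⟨fun hv => ?_, Or.inl hdy, by omega⟩, by omega, by norm_num, by omega, by push_cast at hx ⊢; omega, ?_, ?_⟩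
      · have := hV _ _ hv; omega
      · rintro cx cy (hv | ⟨rfl, rfl⟩)
        · have := hV _ _ hv; push_cast at this ⊢; omega
        · push_cast at hx ⊢; omega
      · intro j hj0 hj1
        push_cast at hj1 hx
        by_cases hj : j ≤ (k : ℤ) + 1
        · exact Or.inl (hrun j hj0 hj)
        · exact Or.inr ⟨by omega, by omega⟩
  · simp only [rungT] at hs
    by_cases he : Even (p + k + 1)
    · rw [if_pos he, Option.some.injEq] at hs; subst hs
      rw [Nat.even_iff] at he
      have he' : ((p : ℤ) + k + 1) % 2 = 0 := by exact_mod_cast he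
      have hx2 : x % 2 = 0 := by
        rcases hh with rfl | rfl
        · have : x = ↑p + ↑k + 1 := by rw [hx, hp]; ring
          omega
        · have : x = ↑p - ↑k - 1 := by rw [hx, hp]; ring
          omega
      refine ⟨⟨fun hv => ?_, Or.inr hx2, by omega⟩, by omega, by omega, by rw [hx, hdx]; push_cast; ring,
        fun h0 => absurd h0 (Nat.succ_ne_zero k), fun _ => hh, by rw [hdx, add_zero]; exact hx2, ?_, ?_⟩
      · have := hV _ _ hv; omega
      · rintro cx cy (hv | ⟨rfl, rfl⟩)
        · right; have := hV _ _ hv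
          exact ⟨this.1, this.2.1, by push_cast; exact this.2.2, fun h0 => absurd h0 (Nat.succ_ne_zero k)⟩
        · left; exact ⟨rfl, by omega⟩
      · intro j hj0 hj1
        exact Or.inl (hrun j hj0 (by push_cast at hj1; exact hj1))
    · rw [if_neg he] at hs; exact absurd hs (by simp)

/-- Blocking at `ini k`. [cite: Stanley2012EC1, §4.7] -/
theorem block_ini {k : ℕ} (hp : x0 = p) (hr0 : r0 = 0 ∨ r0 = 1) (hI : InvS x0 r0 x V (ini k) h r)
    (hOK : StepOK V x r ℓ) : (δ p ⟨ini k, h, r⟩ ℓ).isSome := by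
  obtain ⟨hh, rfl, hx, hV, hrun⟩ := hI
  obtain ⟨hfresh, hbond, hstrip⟩ := hOK
  refine δ_isSome_of hr0 (fun _ _ => by simp [fwdT]) (fun hdy h0 hdx => ?_) (fun hdx hdy => ?_) hstrip
  · exfalso; apply hfresh
    exact vcongr (hrun k (by positivity) (by omega))
      (by rcases hh with rfl | rfl <;> omega) (by omega)
  · have he : Even (p + k + 1) := by
      rw [Nat.even_iff]
      have hx2 : x % 2 = 0 := by rcases hbond with h0 | h0 <;> omega
      rcases hh with rfl | rfl
      · have : x = ↑p + ↑k + 1 := by rw [hx, hp]; ring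
        omega
      · have : x = ↑p - ↑k - 1 := by rw [hx, hp]; ring
        omega
    simp [rungT, he]

/-! ### `rg1 a` -/

/-- Transition from `rg1 a`. [cite: Stanley2012EC1, §4.7] -/
theorem step_rg1 {A : ℕ} (hr0 : r0 = 0 ∨ r0 = 1) (hcur : V x r) (hI : InvS x0 r0 x V (rg1 A) h r)
    (hδ : δ p ⟨rg1 A, h, r⟩ ℓ = some ⟨s', h', r'⟩) : StepConcl x0 r0 x V r ℓ s' h' r' := by
  obtain ⟨rfl, hx, hA0, hA1, hx2, hV, hrun⟩ := hI
  rcases δ_eq_some hδ with ⟨hdy, hdx, rfl, rfl, ⟨hne, hback, hs⟩ | ⟨h01, hs⟩⟩ | ⟨hdx, hdy, rfl, rfl, hs⟩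
  · -- reversal into the U-turn: `A = j + 1`
    cases A with
    | zero => exact absurd (hA0 rfl) hne
    | succ j =>
      simp only [backT, Option.some.injEq] at hs; subst hs
      have hh := hA1 (Nat.succ_ne_zero j)
      rw [StepConcl, hback]
      rcases hh with rfl | rfl <;> push_cast at hx hV hrun ⊢
      all_goals
        refine ⟨⟨fun hv => ?_, Or.inl hdy, by omega⟩, by omega, by norm_num, by omega, by omega, j + 1, le_rfl,
          ?_, ?_, ?_⟩
        · rcases hV _ _ hv with hv' | hv' <;> omega
        · intro i hi0 hi1; exact Or.inl (vcongr (hrun i hi0 (by push_cast at hi1 ⊢; omega)) (by omega) rfl)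
        · intro i hi0 hi1
          push_cast at hi0 hi1
          rcases (show i = j ∨ i = j + 1 by omega) with rfl | rfl
          · exact Or.inr ⟨by omega, by omega⟩
          · exact Or.inl (vcongr hcur (by omega) rfl)
        · rintro cx cy (hv | ⟨rfl, rfl⟩)
          · rcases hV _ _ hv with ⟨rfl, rfl⟩ | ⟨rfl, h1, h2, -⟩
            · right; push_cast; refine ⟨rfl, by omega, by omega⟩
            · left; push_cast; refine ⟨rfl, by omega, by omega⟩
          · right; push_cast; refine ⟨by omega, by omega, by omega⟩
  · -- forward (or, from `rg1 0`, either horizontal letter)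
    simp only [fwdT, Option.some.injEq] at hs; subst hs
    -- the old visited sites: the current one, and the initial run, which lies weakly behind `x` for the new heading
    have hold : ∀ cx cy, V cx cy → (cx = x ∧ cy = 1 - r0) ∨ (cy = r0 ∧ Step.dx ℓ * cx ≤ Step.dx ℓ * x) := by
      intro cx cy hv
      rcases hV _ _ hv with hv' | ⟨hcy, h1, h2, h3⟩
      · exact Or.inl hv'
      · right; refine ⟨hcy, ?_⟩
        rcases Nat.eq_zero_or_pos A with hA | hA
        · rw [h3 hA, hx, hA0 hA]; simp
        · have hh := hA1 (by omega)
          have hdxh : Step.dx ℓ = h := by rcases hh with rfl | rfl <;> omega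
          rw [hdxh]; rcases hh with rfl | rfl <;> omega
    have hend : V x r0 := vcongr (hrun A (by positivity) le_rfl) (by rw [hx]) rfl
    rw [StepConcl]
    rcases hdx with hd | hd <;> rw [hd] at hold ⊢
    all_goals
      refine ⟨⟨fun hv => ?_, Or.inl hdy, by omega⟩, by omega, by norm_num, by push_cast; omega, ?_, ?_, ?_, ?_⟩
      · rcases hold _ _ hv with hv' | hv' <;> omega
      · rintro cx cy (hv | ⟨rfl, rfl⟩)
        · right; rcases hold _ _ hv with ⟨rfl, rfl⟩ | ⟨-, h1⟩ <;> omega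
        · left; exact ⟨rfl, by omega⟩
      · rintro cx cy (hv | ⟨rfl, rfl⟩) hcy
        · rcases hold _ _ hv with ⟨rfl, rfl⟩ | ⟨-, h1⟩ <;> push_cast <;> omega
        · omega
      · exact Or.inl (vcongr hend (by push_cast; omega) (by omega))
      · intro j hj0 hj1
        push_cast at hj1
        rcases (show j = 0 ∨ j = 1 by omega) with rfl | rfl
        · exact Or.inr ⟨by omega, by omega⟩
        · exact Or.inl (vcongr hcur (by omega) rfl)
  · simp [rungT] at hs

/-- Blocking at `rg1 a`. [cite: Stanley2012EC1, §4.7] -/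
theorem block_rg1 {A : ℕ} (hr0 : r0 = 0 ∨ r0 = 1) (hI : InvS x0 r0 x V (rg1 A) h r) (hOK : StepOK V x r ℓ) :
    (δ p ⟨rg1 A, h, r⟩ ℓ).isSome := by
  obtain ⟨rfl, hx, hA0, hA1, hx2, hV, hrun⟩ := hI
  obtain ⟨hfresh, hbond, hstrip⟩ := hOK
  refine δ_isSome_of (by omega) (fun _ _ => by simp [fwdT]) (fun hdy h0 hdx => ?_) (fun hdx hdy => ?_) hstrip
  · cases A with
    | zero => exact absurd (hA0 rfl) h0
    | succ j => simp [backT]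
  · exfalso; apply hfresh
    exact vcongr (hrun A (by positivity) le_rfl) (by rw [hx, hdx]; ring) (by omega)

/-! ### `ut i` -/

/-- Transition from `ut i`. [cite: Stanley2012EC1, §4.7] -/
theorem step_ut {i : ℕ} (hr0 : r0 = 0 ∨ r0 = 1) (hI : InvS x0 r0 x V (ut i) h r)
    (hδ : δ p ⟨ut i, h, r⟩ ℓ = some ⟨s', h', r'⟩) : StepConcl x0 r0 x V r ℓ s' h' r' := by
  obtain ⟨hh, rfl, hx, A, hiA, hinit, hut, hV⟩ := hI
  rcases δ_eq_some hδ with ⟨hdy, hdx, rfl, rfl, ⟨-, -, hs⟩ | ⟨h01, hs⟩⟩ | ⟨hdx, hdy, rfl, rfl, hs⟩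
  · simp [backT] at hs
  · have hdxh : Step.dx ℓ = h := by rcases hh with rfl | rfl <;> omega
    rw [StepConcl, hdxh]
    cases i with
    | zero =>
      simp only [fwdT, Option.some.injEq] at hs; subst hs
      rcases hh with rfl | rfl <;> push_cast at hx hV hut hinit ⊢
      all_goals
        refine ⟨⟨fun hv => ?_, Or.inl hdy, by omega⟩, by omega, by norm_num, rfl, by omega,
          Or.inl (vcongr (hinit 0 le_rfl (by positivity)) (by omega) rfl), A, ?_, ?_⟩
        · rcases hV _ _ hv with hv' | hv' <;> omega
        · intro j hj0 hj1
          by_cases hj : 0 ≤ j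
          · exact Or.inl (vcongr (hut j hj hj1) (by omega) rfl)
          · exact Or.inr ⟨by omega, by omega⟩
        · rintro cx cy (hv | ⟨rfl, rfl⟩)
          · rcases hV _ _ hv with ⟨rfl, h1, h2⟩ | ⟨rfl, h1, h2⟩
            · exact Or.inl ⟨rfl, by omega, by omega⟩
            · exact Or.inr ⟨rfl, by omega, by omega⟩
          · exact Or.inr ⟨by omega, by omega, by omega⟩
    | succ i =>
      simp only [fwdT, Option.some.injEq] at hs; subst hs
      rcases hh with rfl | rfl <;> push_cast at hx hV hut hinit hiA ⊢
      all_goals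
        refine ⟨⟨fun hv => ?_, Or.inl hdy, by omega⟩, by omega, by norm_num, rfl, by omega, A, by omega, ?_, ?_, ?_⟩
        · rcases hV _ _ hv with hv' | hv' <;> omega
        · intro j hj0 hj1; exact Or.inl (hinit j hj0 hj1)
        · intro j hj0 hj1
          by_cases hj : (i : ℤ) + 1 ≤ j
          · exact Or.inl (vcongr (hut j hj hj1) (by omega) rfl)
          · exact Or.inr ⟨by omega, by omega⟩
        · rintro cx cy (hv | ⟨rfl, rfl⟩)
          · rcases hV _ _ hv with ⟨rfl, h1, h2⟩ | ⟨rfl, h1, h2⟩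
            · exact Or.inl ⟨rfl, by omega, by omega⟩
            · exact Or.inr ⟨rfl, by omega, by omega⟩
          · exact Or.inr ⟨by omega, by omega, by omega⟩
  · simp [rungT] at hs

/-- Blocking at `ut i`. [cite: Stanley2012EC1, §4.7] -/
theorem block_ut {i : ℕ} (hr0 : r0 = 0 ∨ r0 = 1) (hI : InvS x0 r0 x V (ut i) h r) (hOK : StepOK V x r ℓ) :
    (δ p ⟨ut i, h, r⟩ ℓ).isSome := by
  obtain ⟨hh, rfl, hx, A, hiA, hinit, hut, hV⟩ := hI
  obtain ⟨hfresh, hbond, hstrip⟩ := hOK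
  refine δ_isSome_of (by omega) (fun _ _ => by cases i <;> simp [fwdT]) (fun hdy h0 hdx => ?_) (fun hdx hdy => ?_) hstrip
  · exfalso; apply hfresh
    exact vcongr (hut (i + 1) (by omega) (by exact_mod_cast hiA))
      (by rcases hh with rfl | rfl <;> omega) (by omega)
  · exfalso; apply hfresh
    exact vcongr (hinit i (by positivity) (by omega)) (by rw [hx, hdx]; ring) (by omega)

/-! ### `up k` -/

/-- Transition from `up k`. [cite: Stanley2012EC1, §4.7] -/
theorem step_up {k : ℕ} (hp : x0 = p) (hr0 : r0 = 0 ∨ r0 = 1) (hI : InvS x0 r0 x V (up k) h r)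
    (hδ : δ p ⟨up k, h, r⟩ ℓ = some ⟨s', h', r'⟩) : StepConcl x0 r0 x V r ℓ s' h' r' := by
  obtain ⟨hh, rfl, hx, hst, A, hext, hV⟩ := hI
  rcases δ_eq_some hδ with ⟨hdy, hdx, rfl, rfl, ⟨-, -, hs⟩ | ⟨h01, hs⟩⟩ | ⟨hdx, hdy, rfl, rfl, hs⟩
  · simp [backT] at hs
  · simp only [fwdT, Option.some.injEq] at hs; subst hs
    have hdxh : Step.dx ℓ = h := by rcases hh with rfl | rfl <;> omega
    rw [StepConcl, hdxh]
    rcases hh with rfl | rfl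
    all_goals
      refine ⟨⟨fun hv => ?_, Or.inl hdy, by omega⟩, by omega, by norm_num, rfl, by omega, Or.inl hst, A, ?_, ?_⟩
      · rcases hV _ _ hv with hv' | hv' <;> omega
      · intro j hj0 hj1
        by_cases hj : -((k : ℤ) + 1) ≤ j
        · exact Or.inl (vcongr (hext j hj hj1) (by omega) rfl)
        · exact Or.inr ⟨by omega, by omega⟩
      · rintro cx cy (hv | ⟨rfl, rfl⟩)
        · rcases hV _ _ hv with ⟨rfl, h1, h2⟩ | ⟨rfl, h1, h2⟩
          · exact Or.inl ⟨rfl, by omega, by omega⟩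
          · exact Or.inr ⟨rfl, by omega, by omega⟩
        · exact Or.inr ⟨by omega, by omega, by omega⟩
  · simp only [rungT] at hs
    by_cases he : Even (p + k + 1)
    · rw [if_pos he, Option.some.injEq] at hs; subst hs
      rw [Nat.even_iff] at he
      have he' : ((p : ℤ) + k + 1) % 2 = 0 := by exact_mod_cast he
      have hx2 : x % 2 = 0 := by
        rcases hh with rfl | rfl
        · have : x = ↑p + ↑k + 1 := by rw [hx, hp]; ring
          omega
        · have : x = ↑p - ↑k - 1 := by rw [hx, hp]; ring
          omega
      rw [StepConcl, hdx]
      rcases hh with rfl | rfl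
      all_goals
        refine ⟨⟨fun hv => ?_, Or.inr hx2, by omega⟩, by omega, by norm_num, by rw [add_zero]; exact hx2, ?_, ?_,
          Or.inl (vcongr hst (by omega) (by omega)), ?_⟩
        · rcases hV _ _ hv with hv' | hv' <;> omega
        · rintro cx cy (hv | ⟨rfl, rfl⟩)
          · rcases hV _ _ hv with hv' | hv' <;> omega
          · omega
        · rintro cx cy (hv | ⟨rfl, rfl⟩) hcy
          · right; rcases hV _ _ hv with hv' | hv' <;> omega
          · left; omega
        · intro j hj0 hj1
          exact Or.inl (vcongr (hext (j - k - 1) (by omega) (by omega)) (by omega) (by omega))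
    · rw [if_neg he] at hs; exact absurd hs (by simp)

/-- Blocking at `up k`. [cite: Stanley2012EC1, §4.7] -/
theorem block_up {k : ℕ} (hp : x0 = p) (hr0 : r0 = 0 ∨ r0 = 1) (hI : InvS x0 r0 x V (up k) h r)
    (hOK : StepOK V x r ℓ) : (δ p ⟨up k, h, r⟩ ℓ).isSome := by
  obtain ⟨hh, rfl, hx, hst, A, hext, hV⟩ := hI
  obtain ⟨hfresh, hbond, hstrip⟩ := hOK
  refine δ_isSome_of (by omega) (fun _ _ => by simp [fwdT]) (fun hdy h0 hdx => ?_) (fun hdx hdy => ?_) hstrip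
  · exfalso; apply hfresh
    exact vcongr (hext (-k) (by omega) (by omega)) (by rcases hh with rfl | rfl <;> omega)
      (by omega)
  · have he : Even (p + k + 1) := by
      rw [Nat.even_iff]
      have hx2 : x % 2 = 0 := by rcases hbond with h0 | h0 <;> omega
      rcases hh with rfl | rfl
      · have : x = ↑p + ↑k + 1 := by rw [hx, hp]; ring
        omega
      · have : x = ↑p - ↑k - 1 := by rw [hx, hp]; ring
        omega
    simp [rungT, he]

/-! ### `fwd k` -/

/-- Transition from `fwd k`. [cite: Stanley2012EC1, §4.7] -/
theorem step_fwd {k : ℕ} (hr : r = 0 ∨ r = 1) (hcur : V x r) (hI : InvS x0 r0 x V (fwd k) h r)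
    (hδ : δ p ⟨fwd k, h, r⟩ ℓ = some ⟨s', h', r'⟩) : StepConcl x0 r0 x V r ℓ s' h' r' := by
  obtain ⟨hh, hc2, hF1, hF2, hF3, hrun⟩ := hI
  rcases δ_eq_some hδ with ⟨hdy, hdx, rfl, rfl, ⟨-, -, hs⟩ | ⟨h01, hs⟩⟩ | ⟨hdx, hdy, rfl, rfl, hs⟩
  · simp [backT] at hs
  · simp only [fwdT, Option.some.injEq] at hs; subst hs
    have hdxh : Step.dx ℓ = h := by rcases hh with rfl | rfl <;> omega
    rw [StepConcl, hdxh]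
    rcases hh with rfl | rfl
    all_goals
      refine ⟨⟨fun hv => ?_, Or.inl hdy, by omega⟩, by omega, by norm_num, by omega, ?_, ?_,
        Or.inl (vcongr hF3 (by omega) (by omega)), ?_⟩
      · rcases hF1 _ _ hv with hv' | hv' <;> omega
      · rintro cx cy (hv | ⟨rfl, rfl⟩)
        · right; rcases hF1 _ _ hv with hv' | hv' <;> omega
        · left; exact ⟨rfl, by omega⟩
      · rintro cx cy (hv | ⟨rfl, rfl⟩) hcy
        · have := hF2 _ _ hv hcy; omega
        · omega
      · intro j hj0 hj1
        by_cases hj : 1 ≤ j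
        · exact Or.inl (vcongr (hrun (j - 1) (by omega) (by omega)) (by omega) rfl)
        · exact Or.inr ⟨by omega, by omega⟩
  · simp only [rungT] at hs
    by_cases he : Even (k + 1)
    · rw [if_pos he, Option.some.injEq] at hs; subst hs
      rw [Nat.even_iff] at he
      have hx2 : x % 2 = 0 := by
        rcases hh with rfl | rfl
        · have : (x - (↑k + 1)) % 2 = 0 := by simpa using hc2
          omega
        · have : (x + (↑k + 1)) % 2 = 0 := by have := hc2; ring_nf at this ⊢; omega
          omega
      rw [StepConcl, hdx]
      rcases hh with rfl | rfl
      all_goals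
        refine ⟨⟨fun hv => ?_, Or.inr hx2, by omega⟩, by omega, by norm_num, by rw [add_zero]; exact hx2, ?_, ?_,
          Or.inl (vcongr hF3 (by omega) (by omega)), ?_⟩
        · rcases hF1 _ _ hv with hv' | hv' <;> omega
        · rintro cx cy (hv | ⟨rfl, rfl⟩)
          · rcases hF1 _ _ hv with hv' | hv' <;> omega
          · omega
        · rintro cx cy (hv | ⟨rfl, rfl⟩) hcy
          · right; exact hF2 _ _ hv (by omega) |>.trans (by omega)
          · left; omega
        · intro j hj0 hj1
          exact Or.inl (vcongr (hrun j hj0 hj1) (by omega) (by omega))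
    · rw [if_neg he] at hs; exact absurd hs (by simp)

/-- Blocking at `fwd k`. [cite: Stanley2012EC1, §4.7] -/
theorem block_fwd {k : ℕ} (hr : r = 0 ∨ r = 1) (hI : InvS x0 r0 x V (fwd k) h r) (hOK : StepOK V x r ℓ) :
    (δ p ⟨fwd k, h, r⟩ ℓ).isSome := by
  obtain ⟨hh, hc2, hF1, hF2, hF3, hrun⟩ := hI
  obtain ⟨hfresh, hbond, hstrip⟩ := hOK
  refine δ_isSome_of hr (fun _ _ => by simp [fwdT]) (fun hdy h0 hdx => ?_) (fun hdx hdy => ?_) hstrip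
  · exfalso; apply hfresh
    exact vcongr (hrun 1 (by omega) (by omega)) (by rw [hdx]; ring) (by omega)
  · have he : Even (k + 1) := by
      rw [Nat.even_iff]
      have hx2 : x % 2 = 0 := by rcases hbond with h0 | h0 <;> omega
      rcases hh with rfl | rfl
      · have : (x - (↑k + 1)) % 2 = 0 := by simpa using hc2
        omega
      · have : (x + (↑k + 1)) % 2 = 0 := by have := hc2; ring_nf at this ⊢; omega
        omega
    simp [rungT, he]

/-! ### `rg2 k` -/

/-- Transition from `rg2 k`. [cite: Stanley2012EC1, §4.7] -/
theorem step_rg2 {k : ℕ} (hr : r = 0 ∨ r = 1) (hcur : V x r) (hI : InvS x0 r0 x V (rg2 k) h r)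
    (hδ : δ p ⟨rg2 k, h, r⟩ ℓ = some ⟨s', h', r'⟩) : StepConcl x0 r0 x V r ℓ s' h' r' := by
  obtain ⟨hh, hx2, hR1, hR2, hR3, hR6⟩ := hI
  rcases δ_eq_some hδ with ⟨hdy, hdx, rfl, rfl, ⟨hne, hback, hs⟩ | ⟨h01, hs⟩⟩ | ⟨hdx, hdy, rfl, rfl, hs⟩
  · -- reversal into the corridor: `k = j + 1`
    cases k with
    | zero => simp [backT] at hs
    | succ j =>
      simp only [backT, Option.some.injEq] at hs; subst hs
      rw [StepConcl, hback]
      rcases hh with rfl | rfl <;> push_cast at hR1 hR2 hR3 hR6 ⊢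
      all_goals
        refine ⟨⟨fun hv => ?_, Or.inl hdy, by omega⟩, by omega, by norm_num, ?_, Or.inl (vcongr hR3 (by omega) rfl), ?_,
          Or.inl (vcongr hcur (by omega) rfl)⟩
        · rcases hR2 _ _ hv (by omega) with hv' | hv' <;> omega
        · rintro i hi0 hi1 (hv | ⟨h1, h2⟩)
          · rcases hR2 _ _ hv rfl with hv' | hv' <;> omega
          · omega
        · intro i hi0 hi1
          exact Or.inl (vcongr (hR6 (i + 1) (by omega) (by omega)) (by omega) rfl)
  · simp only [fwdT, Option.some.injEq] at hs; subst hs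
    have hdxh : Step.dx ℓ = h := by rcases hh with rfl | rfl <;> omega
    rw [StepConcl, hdxh]
    rcases hh with rfl | rfl
    all_goals
      refine ⟨⟨fun hv => ?_, Or.inl hdy, by omega⟩, by omega, by norm_num, by omega, ?_, ?_,
        Or.inl (vcongr (hR6 0 le_rfl (by positivity)) (by omega) rfl), ?_⟩
      · have := hR1 _ _ hv; omega
      · rintro cx cy (hv | ⟨rfl, rfl⟩)
        · right; have := hR1 _ _ hv; omega
        · left; exact ⟨rfl, by omega⟩
      · rintro cx cy (hv | ⟨rfl, rfl⟩) hcy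
        · have := hR1 _ _ hv; omega
        · omega
      · intro j hj0 hj1
        rcases (show j = 0 ∨ j = 1 by omega) with rfl | rfl
        · exact Or.inr ⟨by omega, by omega⟩
        · exact Or.inl (vcongr hcur (by omega) rfl)
  · simp [rungT] at hs

/-- Blocking at `rg2 k`. [cite: Stanley2012EC1, §4.7] -/
theorem block_rg2 {k : ℕ} (hr : r = 0 ∨ r = 1) (hI : InvS x0 r0 x V (rg2 k) h r) (hOK : StepOK V x r ℓ) :
    (δ p ⟨rg2 k, h, r⟩ ℓ).isSome := by
  obtain ⟨hh, hx2, hR1, hR2, hR3, hR6⟩ := hI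
  obtain ⟨hfresh, hbond, hstrip⟩ := hOK
  refine δ_isSome_of hr (fun _ _ => by simp [fwdT]) (fun hdy h0 hdx => ?_) (fun hdx hdy => ?_) hstrip
  · cases k with
    | zero =>
      exfalso; apply hfresh
      exact vcongr hR3 (by rw [hdx]; push_cast; ring) (by omega)
    | succ j => simp [backT]
  · exfalso; apply hfresh
    exact vcongr (hR6 0 le_rfl (by positivity)) (by rw [hdx]; ring) (by omega)

/-! ### `cor j` -/

/-- Transition from `cor j`. [cite: Stanley2012EC1, §4.7] -/
theorem step_cor {j : ℕ} (hr : r = 0 ∨ r = 1) (hcur : V x r) (hI : InvS x0 r0 x V (cor j) h r)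
    (hδ : δ p ⟨cor j, h, r⟩ ℓ = some ⟨s', h', r'⟩) : StepConcl x0 r0 x V r ℓ s' h' r' := by
  obtain ⟨hh, hC1, hC2, hC3, hC4⟩ := hI
  rcases δ_eq_some hδ with ⟨hdy, hdx, rfl, rfl, ⟨-, -, hs⟩ | ⟨h01, hs⟩⟩ | ⟨hdx, hdy, rfl, rfl, hs⟩
  · simp [backT] at hs
  · cases j with
    | zero => simp [fwdT] at hs
    | succ j =>
      simp only [fwdT, Option.some.injEq] at hs; subst hs
      have hdxh : Step.dx ℓ = h := by rcases hh with rfl | rfl <;> omega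
      rw [StepConcl, hdxh]
      rcases hh with rfl | rfl <;> push_cast at hC1 hC2 hC3 hC4 ⊢
      all_goals
        refine ⟨⟨fun hv => hC1 1 le_rfl (by omega) (vcongr hv (by omega) (by omega)), Or.inl hdy, by omega⟩, by omega,
          by norm_num, ?_,
          Or.inl (vcongr hC2 (by omega) rfl), ?_, Or.inl (vcongr hcur (by omega) rfl)⟩
        · rintro i hi0 hi1 (hv | ⟨h1, h2⟩)
          · exact hC1 (i + 1) (by omega) (by omega) (vcongr hv (by omega) rfl)
          · omega
        · intro i hi0 hi1
          exact Or.inl (vcongr (hC3 (i + 1) (by omega) (by omega)) (by omega) rfl)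
  · simp [rungT] at hs

/-- Blocking at `cor j`. [cite: Stanley2012EC1, §4.7] -/
theorem block_cor {j : ℕ} (hr : r = 0 ∨ r = 1) (hI : InvS x0 r0 x V (cor j) h r) (hOK : StepOK V x r ℓ) :
    (δ p ⟨cor j, h, r⟩ ℓ).isSome := by
  obtain ⟨hh, hC1, hC2, hC3, hC4⟩ := hI
  obtain ⟨hfresh, hbond, hstrip⟩ := hOK
  refine δ_isSome_of hr (fun hdy h01 => ?_) (fun hdy h0 hdx => ?_) (fun hdx hdy => ?_) hstrip
  · cases j with
    | zero =>
      exfalso; apply hfresh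
      have hdxh : Step.dx ℓ = h := by
        rcases step_cases ℓ with ⟨-, hdx⟩ | ⟨-, hdy'⟩
        · rcases hh with rfl | rfl <;> omega
        · omega
      exact vcongr hC2 (by rw [hdxh]; push_cast; ring) (by omega)
    | succ j => simp [fwdT]
  · exfalso; apply hfresh
    exact vcongr hC4 (by rw [hdx]; ring) (by omega)
  · exfalso; apply hfresh
    exact vcongr (hC3 0 le_rfl (by positivity)) (by rw [hdx]; ring) (by omega)

/-! ### All states at once -/

/-- **One successful transition from any state: the letter is good and the invariant propagates.**
[cite: Stanley2012EC1, §4.7 (transfer-matrix method)] -/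
theorem step_all {s : LState} (hp : x0 = p) (hr0 : r0 = 0 ∨ r0 = 1) (hr : r = 0 ∨ r = 1) (hcur : V x r)
    (hI : InvS x0 r0 x V s h r) (hδ : δ p ⟨s, h, r⟩ ℓ = some ⟨s', h', r'⟩) : StepConcl x0 r0 x V r ℓ s' h' r' := by
  cases s with
  | start => exact step_start hp hr0 hI hδ
  | ini k => exact step_ini hp hr0 hI hδ
  | rg1 a => exact step_rg1 hr0 hcur hI hδ
  | ut i => exact step_ut hr0 hI hδ
  | up k => exact step_up hp hr0 hI hδ
  | fwd k => exact step_fwd hr hcur hI hδ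
  | rg2 k => exact step_rg2 hr hcur hI hδ
  | cor j => exact step_cor hr hcur hI hδ

/-- **A good letter is never rejected, from any state.** [cite: Stanley2012EC1, §4.7 (transfer-matrix method)] -/
theorem block_all {s : LState} (hp : x0 = p) (hr0 : r0 = 0 ∨ r0 = 1) (hr : r = 0 ∨ r = 1)
    (hI : InvS x0 r0 x V s h r) (hOK : StepOK V x r ℓ) : (δ p ⟨s, h, r⟩ ℓ).isSome := by
  cases s with
  | start => exact block_start hp hr0 hI hOK
  | ini k => exact block_ini hp hr0 hI hOK
  | rg1 a => exact block_rg1 hr0 hI hOK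
  | ut i => exact block_ut hr0 hI hOK
  | up k => exact block_up hp hr0 hI hOK
  | fwd k => exact block_fwd hr hI hOK
  | rg2 k => exact block_rg2 hr hI hOK
  | cor j => exact block_cor hr hI hOK

end steps

/-! ## §9 Words: the automaton accepts exactly the good words; `stripCount 1 N = walkCount N` -/

section accept

variable {p : ℕ} {a : Site 2}

/-- The invariant of a word: current row = the automaton's row (in `{0,1}`) and the arithmetic invariant of its state on the
visited predicate `VisAt a w`. [cite: Stanley2012EC1, §4.7] -/
def WInv (a : Site 2) (w : List Step) (g : GState) : Prop :=
  (a + wEnd w) 1 = g.r ∧ (g.r = 0 ∨ g.r = 1) ∧ InvS (a 0) (a 1) ((a + wEnd w) 0) (VisAt a w) g.s g.h g.r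

/-- A brick-wall bond inside the strip, in coordinates: horizontal, or vertical at an even column.
[cite: EntingJensen2009, §7.4.2, Fig. 7.10] -/
theorem adj_iff_of_rows {u : Site 2} (ℓ : Step) (hu : u 1 = 0 ∨ u 1 = 1)
    (hv : u 1 + Step.dy ℓ = 0 ∨ u 1 + Step.dy ℓ = 1) :
    brickWallGraph.Adj u (u + Step.vec ℓ) ↔ (Step.dy ℓ = 0 ∨ u 0 % 2 = 0) := by
  rw [brickWallGraph_adj_coord]
  simp only [Pi.add_apply, Step.vec_apply_zero, Step.vec_apply_one]
  rcases step_cases ℓ with ⟨hdy, hdx⟩ | ⟨hdx, hdy⟩ <;> constructor <;> intro H <;> omega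

/-- **The main induction**: along a word, `Good` ⟺ accepted, with the invariant. [cite: Stanley2012EC1, §4.7] -/
theorem good_iff_run (hp : a 0 = p) (ha1 : a 1 = 0 ∨ a 1 = 1) (w : List Step) :
    (Good a w → ∃ g, run p (startG a) w = some g ∧ WInv a w g) ∧
      (∀ g, run p (startG a) w = some g → Good a w ∧ WInv a w g) := by
  induction w using List.reverseRecOn with
  | nil =>
    have hI : WInv a [] (startG a) := by
      refine ⟨by simp [startG], by simpa [startG] using ha1, ?_⟩
      simp only [startG, InvS, wEnd_nil, add_zero]
      exact ⟨by trivial, by trivial, by trivial, visAt_start, fun cx cy ⟨i, hi, h0, h1⟩ => by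
        simp only [List.length_nil, Nat.le_zero] at hi; subst hi; simp at h0 h1; exact ⟨h0.symm, h1.symm⟩⟩
    refine ⟨fun _ => ⟨startG a, rfl, hI⟩, fun g hg => ?_⟩
    simp only [run_nil, Option.some.injEq] at hg; subst hg
    exact ⟨good_nil ⟨by omega, by omega⟩, hI⟩
  | append_singleton w ℓ ih =>
    -- common step: from a run of `w` with the invariant and a successful transition, everything about `w ++ [ℓ]`
    have key : ∀ g g', run p (startG a) w = some g → WInv a w g → δ p g ℓ = some g' →
        Good a w → Good a (w ++ [ℓ]) ∧ WInv a (w ++ [ℓ]) g' := by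
      rintro ⟨s, h, r⟩ ⟨s', h', r'⟩ hrun ⟨hrow, hr, hI⟩ hδ hgood
      simp only at hrow hr hI
      obtain ⟨⟨hfresh, hbond, hstrip⟩, hr', hI'⟩ :=
        step_all hp ha1 hr (by rw [← hrow]; exact visAt_end) hI hδ
      have hV : VisAt a (w ++ [ℓ]) = V' (VisAt a w) ((a + wEnd w) 0 + Step.dx ℓ) (r + Step.dy ℓ) := by
        funext cx cy; apply propext; unfold V'; rw [← hrow, visAt_snoc_iff]
        constructor <;> rintro (hv | ⟨h1, h2⟩) <;> first | exact Or.inl hv | exact Or.inr ⟨h1.symm, h2.symm⟩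
      have hrow1 : a 1 + wEnd w 1 = r := by simpa using hrow
      have hpos0 : (a + wEnd (w ++ [ℓ])) 0 = (a + wEnd w) 0 + Step.dx ℓ := by simp [add_assoc]
      have hpos1 : (a + wEnd (w ++ [ℓ])) 1 = (a + wEnd w) 1 + Step.dy ℓ := by simp [add_assoc]
      refine ⟨(good_snoc_iff ℓ).2 ⟨hgood, by rw [hrow]; exact hfresh, ?_, ?_⟩, ?_⟩
      · exact (adj_iff_of_rows ℓ (by rw [hrow]; exact hr) (by rw [hrow]; exact hstrip)).2 hbond
      · refine ⟨?_, ?_⟩ <;> simp only [Pi.add_apply, Step.vec_apply_one, Nat.cast_one] <;> omega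
      · refine ⟨by rw [hpos1, hrow]; exact hr'.symm, by simp only; omega, ?_⟩
        simp only; rw [hpos0, hV]; convert hI' using 2
    refine ⟨fun hgood' => ?_, fun g' hrun' => ?_⟩
    · obtain ⟨hgood, hfresh, hadj, hstrip⟩ := (good_snoc_iff ℓ).1 hgood'
      obtain ⟨g, hrun, hW⟩ := ih.1 hgood
      obtain ⟨hrow, hr, hI⟩ := hW
      have hstrip' : g.r + Step.dy ℓ = 0 ∨ g.r + Step.dy ℓ = 1 := by
        have hrow1 : a 1 + wEnd w 1 = g.r := by simpa using hrow
        rcases hstrip with ⟨h0, h1⟩; simp only [Pi.add_apply, Step.vec_apply_one, Nat.cast_one] at h0 h1; omega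
      have hOK : StepOK (VisAt a w) ((a + wEnd w) 0) g.r ℓ :=
        ⟨by rw [← hrow]; exact hfresh, (adj_iff_of_rows ℓ (by rw [hrow]; exact hr) (by rw [hrow]; exact hstrip')).1 hadj,
          hstrip'⟩
      obtain ⟨g', hδ⟩ := Option.isSome_iff_exists.1 (block_all (s := g.s) (h := g.h) hp ha1 hr hI hOK)
      exact ⟨g', by rw [run_snoc, hrun, Option.bind_some, hδ], (key g g' hrun ⟨hrow, hr, hI⟩ hδ hgood).2⟩
    · rw [run_snoc] at hrun'
      obtain ⟨g, hrun, hδ⟩ := Option.bind_eq_some_iff.1 hrun'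
      obtain ⟨hgood, hW⟩ := ih.2 g hrun
      exact key g g' hrun hW hδ hgood

/-- ★★ **The automaton accepts exactly the step words of the self-avoiding walks of `S_1`** (placed at a cross-section site `a`).
[cite: Stanley2012EC1, §4.7; MadrasSlade1993, §8.2] -/
theorem good_iff_isSome (hp : a 0 = p) (ha1 : a 1 = 0 ∨ a 1 = 1) (w : List Step) :
    Good a w ↔ (run p (startG a) w).isSome := by
  rw [Option.isSome_iff_exists]
  exact ⟨fun h => let ⟨g, hg, _⟩ := (good_iff_run hp ha1 w).1 h; ⟨g, hg⟩,
    fun ⟨g, hg⟩ => ((good_iff_run hp ha1 w).2 g hg).1⟩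

open Classical in
/-- The fibre of `stripPairs 1 N` over a starting site is the image of the accepted words under `traj`.
[cite: MadrasSlade1993, §8.2, eq. (8.2.1)] -/
theorem filter_stripPairs_eq (N : ℕ) (ha : a ∈ stripStarts 1) :
    (stripPairs 1 N).filter (fun q => q.1 = a) = (acc (a 0).toNat (startG a) N).image fun w => (a, traj w) := by
  classical
  obtain ⟨⟨ha0, ha0'⟩, ha1, ha1'⟩ := mem_stripStarts.1 ha
  have hp : a 0 = ((a 0).toNat : ℤ) := (Int.toNat_of_nonneg ha0).symm
  have h1 : a 1 = 0 ∨ a 1 = 1 := by push_cast at ha1'; omega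
  ext q
  obtain ⟨b, ω⟩ := q
  simp only [Finset.mem_filter, Finset.mem_image, acc, mem_words, Prod.mk.injEq]
  constructor
  · rintro ⟨hmem, rfl⟩
    obtain ⟨-, hω, -, -⟩ := mem_stripPairs.1 hmem
    refine ⟨wordOf N ω, ⟨length_wordOf N ω, ?_⟩, rfl, traj_wordOf hω⟩
    rw [← good_iff_isSome hp h1]
    have := (mem_stripPairs_iff_good (a := b) (w := wordOf N ω)).1 (by rw [traj_wordOf hω, length_wordOf]; exact hmem)
    exact this.2
  · rintro ⟨w, ⟨hlen, hacc⟩, rfl, rfl⟩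
    exact ⟨by rw [← hlen]; exact mem_stripPairs_iff_good.2 ⟨ha, (good_iff_isSome hp h1 w).2 hacc⟩, rfl⟩

open Classical in
/-- The fibre count: `#{ω : (a, ω) ∈ stripPairs 1 N} = W (parity of a₀) start N`. [cite: MadrasSlade1993, §8.2] -/
theorem card_filter_stripPairs (N : ℕ) (ha : a ∈ stripStarts 1) :
    ((stripPairs 1 N).filter (fun q => q.1 = a)).card = W (a 0).toNat start N := by
  classical
  obtain ⟨⟨ha0, ha0'⟩, ha1, ha1'⟩ := mem_stripStarts.1 ha
  rw [filter_stripPairs_eq N ha, Finset.card_image_of_injOn]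
  · exact card_acc _ _ _ (by simp [HOk, startG]) (by simp only [startG, Nat.cast_one] at ha1' ⊢; omega)
  · intro w hw w' hw' h
    simp only [Finset.mem_coe, acc, Finset.mem_filter, mem_words] at hw hw'
    simp only [Prod.mk.injEq, true_and] at h
    exact eq_of_traj_eq (hw.1.trans hw'.1.symm) h

/-- The cross-section of `S_1`: the four sites `(0,0), (1,0), (0,1), (1,1)`. [cite: MadrasSlade1993, §8.2, eq. (8.2.1)] -/
theorem stripStarts_one : stripStarts 1 = {![0, 0], ![1, 0], ![0, 1], ![1, 1]} := by
  ext a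
  rw [mem_stripStarts, InStrip]
  simp only [Finset.mem_insert, Finset.mem_singleton, Nat.cast_one]
  constructor
  · rintro ⟨⟨h0, h0'⟩, h1, h1'⟩
    have e0 : a 0 = 0 ∨ a 0 = 1 := by omega
    have e1 : a 1 = 0 ∨ a 1 = 1 := by omega
    rcases e0 with e0 | e0 <;> rcases e1 with e1 | e1 <;>
      [left; (right; right; left); (right; left); (right; right; right)] <;>
      (funext i; fin_cases i <;> assumption)
  · rintro (rfl | rfl | rfl | rfl) <;> simp

/-- ★★★ **The automaton counts the walks of the strip: `c_N(S_1) = walkCount N`.**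
[cite: MadrasSlade1993, §8.2, eq. (8.2.1); Stanley2012EC1, §4.7 (Theorem 4.7.2)] -/
theorem stripCount_one_eq_walkCount (N : ℕ) : stripCount 1 N = walkCount N := by
  classical
  rw [stripCount, Finset.card_eq_sum_card_fiberwise (f := Prod.fst) (t := stripStarts 1)
    (fun q hq => (mem_stripPairs.1 hq).1)]
  rw [Finset.sum_congr rfl fun a ha => card_filter_stripPairs N ha, stripStarts_one]
  rw [Finset.sum_insert (by decide), Finset.sum_insert (by decide), Finset.sum_insert (by decide), Finset.sum_singleton]
  change W 0 start N + (W 1 start N + (W 0 start N + W 1 start N)) = _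
  rw [walkCount]; ring

/-- ★★★ **THE WALK SERIES OF THE ONE-CELL HONEYCOMB STRIP**:
`(Σ_N c_N(S_1) X^N) · (1 − X² − X³)(1 − X⁴)² = 4 + 10X + 12X² + 10X³ + 2X⁴ − 4X⁵ − 12X⁶ − 12X⁷ + 6X⁹ + 2X¹¹ + 2X¹²`, i.e.
`Σ_N c_N(S_1) x^N = (4 + 10x + 12x² + 10x³ + 2x⁴ − 4x⁵ − 12x⁶ − 12x⁷ + 6x⁹ + 2x¹¹ + 2x¹²)/((1 − x² − x³)(1 − x⁴)²)`,
`c_N(S_1) = HexBW.stripCount 1 N` (walks of the honeycomb strip `S_1` up to its translations).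
[cite: BeatonBousquetMelouDeGierDuminilCopinGuttmann2014, §3.2 (arXiv v5 p. 12: the strip series are rational);
Stanley2012EC1, §4.7 (Theorem 4.7.2); AlmJanson1990] -/
theorem stripCount_one_series :
    PowerSeries.mk (fun N => (stripCount 1 N : ℤ)) * ((1 - X ^ 2 - X ^ 3) * (1 - X ^ 4) ^ 2) = walkP := by
  rw [show (PowerSeries.mk fun N => (stripCount 1 N : ℤ)) = PowerSeries.mk fun N => (walkCount N : ℤ) from by
    ext N; rw [coeff_mk, coeff_mk, stripCount_one_eq_walkCount]]
  exact walkCount_series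

/-- ★★ **The linear recurrence of `c_N(S_1)`** (order 11; all `N ≥ 13`):
`c_{n+13} = c_{n+11} + c_{n+10} + 2c_{n+9} − 2c_{n+7} − 2c_{n+6} − c_{n+5} + c_{n+3} + c_{n+2}`.
[cite: Stanley2012EC1, §4.1 (Theorem 4.1.1)] -/
theorem stripCount_one_rec (n : ℕ) :
    (stripCount 1 (n + 13) : ℤ) = stripCount 1 (n + 11) + stripCount 1 (n + 10) + 2 * stripCount 1 (n + 9)
      - 2 * stripCount 1 (n + 7) - 2 * stripCount 1 (n + 6) - stripCount 1 (n + 5) + stripCount 1 (n + 3)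
      + stripCount 1 (n + 2) := by
  simp only [stripCount_one_eq_walkCount]; exact walkCount_rec n

/-- The first values: `c_N(S_1) = 4, 10, 16, 24, 36, 56, 72` for `N = 0, …, 6`. [cite: MadrasSlade1993, §8.2] -/
theorem stripCount_one_values : (List.range 7).map (stripCount 1) = [4, 10, 16, 24, 36, 56, 72] := by
  rw [show stripCount 1 = walkCount from funext stripCount_one_eq_walkCount]; decide

end accept

section closedform

/-! ## §CF (ed.3) A closed form à la Zeilberger: `25·c_N(S_1) = u_N − ε(N)` with a plastic (Padovan-type) recurrence

By Stanley's Theorem 4.1.1 the rational series `P/((1 − X² − X³)(1 − X⁴)²)` has coefficients of the shape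
"(solution of the recurrence `t³ = t + 1`) + (polynomial-periodic part from `(1 − X⁴)²`)"; here both parts are
integral after multiplying by `25`, and the periodic part is LINEAR on each residue class mod `4` — the honeycomb
analogue of Zeilberger's `a_n = 8F_n − ([n even]·n + [n odd]·4)` for the square ladder (`SAWLadderZeilberger.lean`). -/

/-- The Padovan-type sequence `u_N`: `u_0 = 436`, `u_1 = 592`, `u_2 = 724`, `u_{N+3} = u_{N+1} + u_N` (characteristic
polynomial `t³ − t − 1`, whose real root is the plastic number `ρ = μ(S_1)`).
[cite: Stanley2012EC1, §4.1 (Theorem 4.1.1 (iii): exponential-polynomial form of the coefficients of a rational function)] -/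
def plast : ℕ → ℤ
  | 0 => 436
  | 1 => 592
  | 2 => 724
  | n + 3 => plast (n + 1) + plast n

/-- The correction term `ε(N)`, linear on each residue class mod `4`: `336 + 20N`, `277 + 15N`, `214 + 55N`, `323 + 35N`
for `N ≡ 0, 1, 2, 3 (mod 4)` (the contribution of the double pole factor `(1 − X⁴)²`).
[cite: Stanley2012EC1, §4.1 (Theorem 4.1.1 (iii))] -/
def corr (N : ℕ) : ℤ :=
  if N % 4 = 0 then 336 + 20 * N else if N % 4 = 1 then 277 + 15 * N
  else if N % 4 = 2 then 214 + 55 * N else 323 + 35 * N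

/-- `ε(N) = 336 + 20N` for `N ≡ 0 (mod 4)`. [cite: Stanley2012EC1, §4.1 (Theorem 4.1.1 (iii))] -/
theorem corr_of_mod_zero {N : ℕ} (h : N % 4 = 0) : corr N = 336 + 20 * N := by simp [corr, h]

/-- `ε(N) = 277 + 15N` for `N ≡ 1 (mod 4)`. [cite: Stanley2012EC1, §4.1 (Theorem 4.1.1 (iii))] -/
theorem corr_of_mod_one {N : ℕ} (h : N % 4 = 1) : corr N = 277 + 15 * N := by simp [corr, h]

/-- `ε(N) = 214 + 55N` for `N ≡ 2 (mod 4)`. [cite: Stanley2012EC1, §4.1 (Theorem 4.1.1 (iii))] -/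
theorem corr_of_mod_two {N : ℕ} (h : N % 4 = 2) : corr N = 214 + 55 * N := by simp [corr, h]

/-- `ε(N) = 323 + 35N` for `N ≡ 3 (mod 4)`. [cite: Stanley2012EC1, §4.1 (Theorem 4.1.1 (iii))] -/
theorem corr_of_mod_three {N : ℕ} (h : N % 4 = 3) : corr N = 323 + 35 * N := by simp [corr, h]

/-- `u_N − ε(N)` satisfies the order-`11` recurrence of `c_N(S_1)` (`stripCount_one_rec`): `(1 − X² − X³)` annihilates
`u` and `(1 − X⁴)²` annihilates `ε`. [cite: Stanley2012EC1, §4.1 (Theorem 4.1.1)] -/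
theorem plast_sub_corr_rec (n : ℕ) :
    plast (n + 13) - corr (n + 13) = (plast (n + 11) - corr (n + 11)) + (plast (n + 10) - corr (n + 10))
      + 2 * (plast (n + 9) - corr (n + 9)) - 2 * (plast (n + 7) - corr (n + 7)) - 2 * (plast (n + 6) - corr (n + 6))
      - (plast (n + 5) - corr (n + 5)) + (plast (n + 3) - corr (n + 3)) + (plast (n + 2) - corr (n + 2)) := by
  have e3 : plast (n + 3) = plast (n + 1) + plast n := rfl
  have e4 : plast (n + 4) = plast (n + 2) + plast (n + 1) := rfl
  have e5 : plast (n + 5) = plast (n + 3) + plast (n + 2) := rfl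
  have e6 : plast (n + 6) = plast (n + 4) + plast (n + 3) := rfl
  have e7 : plast (n + 7) = plast (n + 5) + plast (n + 4) := rfl
  have e8 : plast (n + 8) = plast (n + 6) + plast (n + 5) := rfl
  have e9 : plast (n + 9) = plast (n + 7) + plast (n + 6) := rfl
  have e10 : plast (n + 10) = plast (n + 8) + plast (n + 7) := rfl
  have e11 : plast (n + 11) = plast (n + 9) + plast (n + 8) := rfl
  have e12 : plast (n + 12) = plast (n + 10) + plast (n + 9) := rfl
  have e13 : plast (n + 13) = plast (n + 11) + plast (n + 10) := rfl
  obtain ⟨r, hr, hn⟩ : ∃ r, r < 4 ∧ n % 4 = r := ⟨n % 4, Nat.mod_lt _ (by norm_num), rfl⟩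
  interval_cases r
  · rw [corr_of_mod_one (N := n + 13) (by omega), corr_of_mod_three (N := n + 11) (by omega),
      corr_of_mod_two (N := n + 10) (by omega), corr_of_mod_one (N := n + 9) (by omega),
      corr_of_mod_three (N := n + 7) (by omega), corr_of_mod_two (N := n + 6) (by omega),
      corr_of_mod_one (N := n + 5) (by omega), corr_of_mod_three (N := n + 3) (by omega),
      corr_of_mod_two (N := n + 2) (by omega)]
    push_cast
    omega
  · rw [corr_of_mod_two (N := n + 13) (by omega), corr_of_mod_zero (N := n + 11) (by omega),
      corr_of_mod_three (N := n + 10) (by omega), corr_of_mod_two (N := n + 9) (by omega),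
      corr_of_mod_zero (N := n + 7) (by omega), corr_of_mod_three (N := n + 6) (by omega),
      corr_of_mod_two (N := n + 5) (by omega), corr_of_mod_zero (N := n + 3) (by omega),
      corr_of_mod_three (N := n + 2) (by omega)]
    push_cast
    omega
  · rw [corr_of_mod_three (N := n + 13) (by omega), corr_of_mod_one (N := n + 11) (by omega),
      corr_of_mod_zero (N := n + 10) (by omega), corr_of_mod_three (N := n + 9) (by omega),
      corr_of_mod_one (N := n + 7) (by omega), corr_of_mod_zero (N := n + 6) (by omega),
      corr_of_mod_three (N := n + 5) (by omega), corr_of_mod_one (N := n + 3) (by omega),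
      corr_of_mod_zero (N := n + 2) (by omega)]
    push_cast
    omega
  · rw [corr_of_mod_zero (N := n + 13) (by omega), corr_of_mod_two (N := n + 11) (by omega),
      corr_of_mod_one (N := n + 10) (by omega), corr_of_mod_zero (N := n + 9) (by omega),
      corr_of_mod_two (N := n + 7) (by omega), corr_of_mod_one (N := n + 6) (by omega),
      corr_of_mod_zero (N := n + 5) (by omega), corr_of_mod_two (N := n + 3) (by omega),
      corr_of_mod_one (N := n + 2) (by omega)]
    push_cast
    omega

/-- `25·walkCount N = u_N − ε(N)` for `2 ≤ N` (also at `N = 0`; it fails only at `N = 1`, where `250 ≠ 300` — the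
numerator of the series has degree `12 = 11 + 1`). [cite: Stanley2012EC1, §4.1 (Theorem 4.1.1 (iii))] -/
theorem walkCount_closed_form (N : ℕ) (hN : 2 ≤ N) : 25 * (walkCount N : ℤ) = plast N - corr N := by
  induction N using Nat.strong_induction_on with
  | _ N ih =>
    rcases lt_or_ge N 13 with hlt | hge
    · interval_cases N <;> decide
    · obtain ⟨n, rfl⟩ : ∃ n, N = n + 13 := ⟨N - 13, by omega⟩
      have hr := walkCount_rec n
      have hp := plast_sub_corr_rec n
      have i11 := ih (n + 11) (by omega) (by omega)
      have i10 := ih (n + 10) (by omega) (by omega)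
      have i9 := ih (n + 9) (by omega) (by omega)
      have i7 := ih (n + 7) (by omega) (by omega)
      have i6 := ih (n + 6) (by omega) (by omega)
      have i5 := ih (n + 5) (by omega) (by omega)
      have i3 := ih (n + 3) (by omega) (by omega)
      have i2 := ih (n + 2) (by omega) (by omega)
      omega

/-- ★★ **Closed form for the walk counts of the width-one honeycomb strip** (à la Zeilberger): for `N ≥ 2`,
`25 · c_N(S_1) = u_N − ε(N)`, where `u_0, u_1, u_2 = 436, 592, 724`, `u_{N+3} = u_{N+1} + u_N` (plastic-number
recurrence) and `ε(N) = 336 + 20N, 277 + 15N, 214 + 55N, 323 + 35N` according as `N ≡ 0, 1, 2, 3 (mod 4)`.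
E.g. `N = 12`: `u_12 = 12 576`, `ε(12) = 576`, `c_12 = 12 000/25 = 480` ✓. In particular `c_N(S_1) = u_N/25 + O(N)`
with `u_N` of pure plastic growth. [cite: Stanley2012EC1, §4.1 (Theorem 4.1.1 (iii))]
[cite: MadrasSlade1993, §8.2 (c_N(S_T))] -/
theorem stripCount_one_closed_form (N : ℕ) (hN : 2 ≤ N) : 25 * (stripCount 1 N : ℤ) = plast N - corr N := by
  rw [stripCount_one_eq_walkCount]; exact walkCount_closed_form N hN

end closedform






end WidthOne


end Literature.Probability.RandomPlanarGeometry.SAW.HexBW
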